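import Literature.NumberTheory.GaloisRepresentations.WeakAbelianDirectSummandAlmostLocAlgProofs
import Literature.NumberTheory.Transcendental.PadicLogAlgClProofs
import Literature.NumberTheory.Transcendental.SixExponentialsPadicProofs
import Mathlib.RingTheory.Discriminant
import Mathlib.NumberTheory.NumberField.Discriminant.Defs
import HarnessLib

/-!
# The `ℓ`-adic analytic expansion of idelic characters at the places above `ℓ` (proved)

Topic `NumberTheory/GaloisRepresentations`; namespace
`Literature.NumberTheory.GaloisRepresentations`.  A *proofs* file (theorems only; no definition,
no named fact, no instance).

**Theorem** (`Expansion.exists_expansion`).  Let `K` be a number field, `ℓ` a prime,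
`Ψ : 𝕀_K → ℚ̄_ℓˣ` a continuous character, `ι : ℚ̄_ℓ → E` an isometric ring embedding into a
complete ultrametric normed `ℚ_ℓ`-algebra field `E` (e.g. `ℂ_ℓ`), `L` a set of places above `ℓ`
and `ε > 0`.  There are a depth `s ≥ 2` and coefficients `λ_τ`, `μ_{τ₀,τ} ∈ E`, indexed by the
embeddings `τ, τ₀ : K → ℚ̄_ℓ`, such that for every `k ∈ Kˣ` with `k ≡ 1 [ℓ^s]`
(`|k - 1|_v ≤ |ℓ^s|_v` at every `v ∣ ℓ`), with `L_τ(k) := -∑_{m ≥ 1} (1 - ι τ k)^m / m` the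
logarithmic series,

  `ι(∏_{v ∈ L} Ψ(⟨k⟩_v)) = exp(∑_τ λ_τ L_τ(k))`  and  `ι(τ₀ k) = exp(∑_τ μ_{τ₀,τ} L_τ(k))`,

both exponents of norm `< ε`.  This is the analytic structure of continuous characters of the
`ℓ`-adic Lie group `∏_{v∣ℓ} K_vˣ` near `1` ("`φ ∘ i_ℓ(x) = exp(λ · log x)`", the starting point of
Serre's local algebraicity theory, *Abelian ℓ-adic representations*, Ch. III §1.1, and of
Böckle–Hui §2.3), obtained here GLOBALLY, on the dense subgroup of global elements, without
completions or local fields: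

* **Part A0** (`LogE.*`): the logarithmic series on principal units of `E` — Lipschitz bound,
  second-order bound `‖L(y) + (1 - y)‖ ≤ 2‖1 - y‖²`, isometry and injectivity near `1`,
  functoriality on inverses, quotients, finite products and powers (from the tree's functional
  equation `IwasawaLog.logSeries_mul`).
* **Part A1** (`Cong.*`): the calculus of the congruences `x ≡ 0 [ℓ^j]` (all places above `ℓ` at
  once), the binomial tower `(1 + y)^{ℓ^r a} ≡ 1 + a ℓ^r y [ℓ^{r+s+1}]` for `y ≡ 0 [ℓ^s]`,
  `s ≥ 2`, denominators prime to `ℓ`, residues modulo `ℓ` through a `ℤ`-basis of `𝓞_K`, and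
  **successive approximation** (`Cong.exists_monomial`): every `k ≡ 1 [ℓ^s]` is congruent modulo
  `ℓ^{s+n}` to a monomial `∏_σ γ_σ^{A_σ}`, `γ_σ = 1 + ℓ^s b_σ`, `A_σ ∈ ℕ`.
* **Part A2** (`Expansion.exists_basis_det_ne_zero`, `exists_forall_det_ne_zero`): a `ℤ`-basis
  `(b_σ)` of `𝓞_K` indexed by the embeddings, whose embedding matrix `(τ b_σ)` is invertible
  (its determinant squares to a discriminant, Mathlib
  `Algebra.discr_eq_det_embeddingsMatrixReindex_pow_two`), and the invertibility of the
  logarithmic matrix `(L(ι τ γ_σ))_{σ,τ} = ℓ^s((ι τ b_σ) + O(ℓ^s))` for large `s` (continuity of the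
  determinant).
* **Part A3** (`Expansion.key`, `exists_expansion`): along the approximating monomials the
  exponent vectors `A(n) ∈ ℕ^{Emb}` converge in `E^{Emb}` (inverting the logarithmic matrix), a
  multiplicative `Φ` with `Φ(γ_σ) = exp c_σ` satisfies `Φ(γ^{A(n)}) = exp(A(n) · c)`, and
  continuity (`Ψ` in the congruence topology, `IdelicCharacter.exists_forall_valued_le_norm_sub_one_lt`;
  the embeddings, `norm_embedding_le_of_cong`; `exp` on its ball) gives the expansions.

It is the input of the transcendence step (six exponentials / Waldschmidt) in the proof of
Böckle–Hui's Thm. 2.2 (`WeakAbelianDirectSummandOfThm22Proofs`, hypothesis `h22`).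

## References

* J.-P. Serre, *Abelian ℓ-adic representations and elliptic curves* (1968), Ch. III §1.1.
  [SerreAbelianLadic1968]
* G. Böckle, C.-Y. Hui, Math. Ann. 393 (2025), §2.3. [BockleHui2025]
* K. Iwasawa, *Lectures on p-adic L-functions* (1972), §4.4 (the logarithm). [Iwasawa1972PadicL]
-/

noncomputable section

section PartA0
open Filter Topology Finset
open Literature.NumberTheory.Transcendental

namespace Literature.NumberTheory.GaloisRepresentations

namespace LogE

/-- `(n + 2) r^{n+2} ≤ r/2` for `0 ≤ r ≤ 1/4`. [folklore] -/
theorem succ_succ_mul_pow_le {r : ℝ} (hr0 : 0 ≤ r) (hr : r ≤ 1 / 4) (n : ℕ) :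
    ((n + 1 + 1 : ℕ) : ℝ) * r ^ (n + 1 + 1) ≤ r / 2 := by
  have h2 : ((n + 1 + 1 : ℕ) : ℝ) ≤ 2 * (4 : ℝ) ^ n := by
    have : n + 1 + 1 ≤ 2 * 4 ^ n := by
      induction n with
      | zero => norm_num
      | succ k ih => rw [pow_succ]; omega
    exact_mod_cast this
  have h3 : ((n + 1 + 1 : ℕ) : ℝ) * r ^ (n + 1) ≤ 1 / 2 := by
    calc ((n + 1 + 1 : ℕ) : ℝ) * r ^ (n + 1) ≤ (2 * (4 : ℝ) ^ n) * (1 / 4 : ℝ) ^ (n + 1) := by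
          gcongr
      _ = 1 / 2 := by rw [pow_succ, ← mul_assoc, mul_assoc 2, ← mul_pow]; norm_num
  calc ((n + 1 + 1 : ℕ) : ℝ) * r ^ (n + 1 + 1) = (((n + 1 + 1 : ℕ) : ℝ) * r ^ (n + 1)) * r := by
        ring
    _ ≤ (1 / 2) * r := by gcongr
    _ = r / 2 := by ring

variable {ℓ : ℕ} [Fact ℓ.Prime] {E : Type} [NontriviallyNormedField E] [NormedAlgebra ℚ_[ℓ] E]
  [IsUltrametricDist E] [CompleteSpace E]

include ℓ

omit [CompleteSpace E] in
/-- **Lipschitz bound** `‖L(y)‖ ≤ ‖1 - y‖` for `‖1 - y‖ ≤ 1/2`, `L(y) = -∑ (1-y)^{n+1}/(n+1)`.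
[folklore] -/
theorem norm_logSeries_le {y : E} (hy : ‖1 - y‖ ≤ 1 / 2) :
    ‖∑' n : ℕ, -((1 - y) ^ (n + 1)) / (n + 1 : E)‖ ≤ ‖1 - y‖ := by
  refine IsUltrametricDist.norm_tsum_le_of_forall_le_of_nonneg (norm_nonneg _) fun n ↦ ?_
  exact (IwasawaLog.norm_logTerm_le (p := ℓ) (1 - y) n).trans
    (IwasawaLog.succ_mul_pow_succ_le (norm_nonneg _) hy n)

/-- **Isometry near `1`**: `‖L(y)‖ = ‖1 - y‖` for `‖1 - y‖ ≤ 1/4` (the tail `∑_{n≥2}` has norm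
`≤ ‖1 - y‖/2`). [folklore] -/
theorem norm_logSeries_eq {y : E} (hy : ‖1 - y‖ ≤ 1 / 4) :
    ‖∑' n : ℕ, -((1 - y) ^ (n + 1)) / (n + 1 : E)‖ = ‖1 - y‖ := by
  by_cases h0 : 1 - y = 0
  · rw [h0]; simp
  have hpos : 0 < ‖1 - y‖ := norm_pos_iff.mpr h0
  have hsum : Summable fun n : ℕ ↦ -((1 - y) ^ (n + 1)) / (n + 1 : E) :=
    IwasawaLog.summable_logTerm (p := ℓ) (hy.trans_lt (by norm_num))
  rw [hsum.tsum_eq_zero_add]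
  have hfirst : -((1 - y) ^ (0 + 1)) / ((0 : ℕ) + 1 : E) = -(1 - y) := by simp
  have htail : ‖∑' n : ℕ, -((1 - y) ^ (n + 1 + 1)) / ((n + 1 : ℕ) + 1 : E)‖ ≤ ‖1 - y‖ / 2 := by
    refine IsUltrametricDist.norm_tsum_le_of_forall_le_of_nonneg (by positivity) fun n ↦ ?_
    have h1 := IwasawaLog.norm_logTerm_le (p := ℓ) (F := E) (1 - y) (n + 1)
    push_cast at h1 ⊢
    exact h1.trans (by exact_mod_cast succ_succ_mul_pow_le (norm_nonneg _) hy n)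
  have hlt : ‖∑' n : ℕ, -((1 - y) ^ (n + 1 + 1)) / ((n + 1 : ℕ) + 1 : E)‖ < ‖-(1 - y)‖ := by
    rw [norm_neg]
    exact htail.trans_lt (by linarith)
  rw [hfirst, IsUltrametricDist.norm_add_eq_max_of_norm_ne_norm (Ne.symm hlt.ne), norm_neg]
  rw [norm_neg] at hlt
  exact max_eq_left hlt.le

omit [CompleteSpace E] in
/-- **Second-order bound** `‖L(y) + (1 - y)‖ ≤ 2 ‖1 - y‖²` for `‖1 - y‖ ≤ 1/2` (the terms
`(1-y)^{n+2}/(n+2)` have norm `≤ (n+2) ‖1-y‖^{n+2} ≤ 2‖1-y‖²`). [folklore] -/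
theorem norm_logSeries_add_le [CompleteSpace E] {y : E} (hy : ‖1 - y‖ ≤ 1 / 2) :
    ‖(∑' n : ℕ, -((1 - y) ^ (n + 1)) / (n + 1 : E)) + (1 - y)‖ ≤ 2 * ‖1 - y‖ ^ 2 := by
  have hsum : Summable fun n : ℕ ↦ -((1 - y) ^ (n + 1)) / (n + 1 : E) :=
    IwasawaLog.summable_logTerm (p := ℓ) (hy.trans_lt (by norm_num))
  rw [hsum.tsum_eq_zero_add]
  have hfirst : -((1 - y) ^ (0 + 1)) / ((0 : ℕ) + 1 : E) = -(1 - y) := by simp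
  rw [hfirst, show -(1 - y) + (∑' n : ℕ, -((1 - y) ^ (n + 1 + 1)) / ((n + 1 : ℕ) + 1 : E)) +
    (1 - y) = ∑' n : ℕ, -((1 - y) ^ (n + 1 + 1)) / ((n + 1 : ℕ) + 1 : E) by ring]
  refine IsUltrametricDist.norm_tsum_le_of_forall_le_of_nonneg (by positivity) fun n ↦ ?_
  have h1 := IwasawaLog.norm_logTerm_le (p := ℓ) (F := E) (1 - y) (n + 1)
  push_cast at h1 ⊢
  refine h1.trans ?_
  -- `(n + 2) r^{n+2} ≤ 2 r^2` for `r ≤ 1/2`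
  set r : ℝ := ‖1 - y‖ with hr
  have hr0 : 0 ≤ r := norm_nonneg _
  have h2 : ((n : ℝ) + 1 + 1) * r ^ n ≤ 2 := by
    have h3 : ((n : ℝ) + 1 + 1) ≤ 2 * (2 : ℝ) ^ n := by
      have : n + 1 + 1 ≤ 2 * 2 ^ n := by
        have h := Nat.lt_two_pow_self (n := n)
        have h' : 1 ≤ 2 ^ n := Nat.one_le_two_pow
        omega
      exact_mod_cast this
    calc ((n : ℝ) + 1 + 1) * r ^ n ≤ (2 * (2 : ℝ) ^ n) * (1 / 2 : ℝ) ^ n := by gcongr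
      _ = 2 := by rw [mul_assoc, ← mul_pow]; norm_num
  calc ((n : ℝ) + 1 + 1) * r ^ (n + 1 + 1) = (((n : ℝ) + 1 + 1) * r ^ n) * r ^ 2 := by ring
    _ ≤ 2 * r ^ 2 := by gcongr

omit ℓ [Fact ℓ.Prime] [NormedAlgebra ℚ_[ℓ] E] [IsUltrametricDist E] [CompleteSpace E] in
/-- `L(1) = 0`. [folklore] -/
theorem logSeries_one : (∑' n : ℕ, -((1 - (1 : E)) ^ (n + 1)) / (n + 1 : E)) = 0 := by
  simp

/-- `L(y⁻¹) = -L(y)` on principal units. [folklore] -/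
theorem logSeries_inv {y : E} (hy : ‖1 - y‖ < 1) :
    (∑' n : ℕ, -((1 - y⁻¹) ^ (n + 1)) / (n + 1 : E)) =
      -∑' n : ℕ, -((1 - y) ^ (n + 1)) / (n + 1 : E) := by
  have hy0 : y ≠ 0 := by
    rintro rfl
    rw [sub_zero, norm_one] at hy
    exact lt_irrefl _ hy
  have h := IwasawaLog.logSeries_mul (p := ℓ) hy (IwasawaLog.norm_one_sub_inv_lt hy)
  rw [mul_inv_cancel₀ hy0, logSeries_one] at h
  linear_combination -h

/-- `L(y / y') = L(y) - L(y')` on principal units. [folklore] -/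
theorem logSeries_div {y y' : E} (hy : ‖1 - y‖ < 1) (hy' : ‖1 - y'‖ < 1) :
    (∑' n : ℕ, -((1 - y / y') ^ (n + 1)) / (n + 1 : E)) =
      (∑' n : ℕ, -((1 - y) ^ (n + 1)) / (n + 1 : E)) -
        ∑' n : ℕ, -((1 - y') ^ (n + 1)) / (n + 1 : E) := by
  rw [div_eq_mul_inv, IwasawaLog.logSeries_mul (p := ℓ) hy (IwasawaLog.norm_one_sub_inv_lt hy'),
    logSeries_inv (ℓ := ℓ) hy', ← sub_eq_add_neg]

omit ℓ [Fact ℓ.Prime] [NormedAlgebra ℚ_[ℓ] E] [CompleteSpace E] in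
/-- Finite products of principal units are principal units. [folklore] -/
theorem norm_one_sub_prod_lt {ι : Type*} (s : Finset ι) (y : ι → E)
    (hy : ∀ i ∈ s, ‖1 - y i‖ < 1) : ‖1 - ∏ i ∈ s, y i‖ < 1 := by
  classical
  induction s using Finset.induction_on with
  | empty => simp
  | insert a s ha ih =>
    rw [Finset.prod_insert ha]
    exact IwasawaLog.norm_one_sub_mul_lt (hy a (Finset.mem_insert_self a s))
      (ih fun i hi => hy i (Finset.mem_insert_of_mem hi))

/-- `L(∏ yᵢ) = ∑ L(yᵢ)` on principal units. [folklore] -/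
theorem logSeries_prod {ι : Type*} (s : Finset ι) (y : ι → E) (hy : ∀ i ∈ s, ‖1 - y i‖ < 1) :
    (∑' n : ℕ, -((1 - ∏ i ∈ s, y i) ^ (n + 1)) / (n + 1 : E)) =
      ∑ i ∈ s, ∑' n : ℕ, -((1 - y i) ^ (n + 1)) / (n + 1 : E) := by
  classical
  induction s using Finset.induction_on with
  | empty => simp
  | insert a s ha ih =>
    rw [Finset.prod_insert ha, Finset.sum_insert ha,
      IwasawaLog.logSeries_mul (p := ℓ) (hy a (Finset.mem_insert_self a s))
        (norm_one_sub_prod_lt s y fun i hi => hy i (Finset.mem_insert_of_mem hi)),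
      ih fun i hi => hy i (Finset.mem_insert_of_mem hi)]

/-- `L(∏ yᵢ^{Aᵢ}) = ∑ Aᵢ L(yᵢ)` on principal units. [folklore] -/
theorem logSeries_prod_pow {ι : Type*} (s : Finset ι) (y : ι → E) (A : ι → ℕ)
    (hy : ∀ i ∈ s, ‖1 - y i‖ < 1) :
    (∑' n : ℕ, -((1 - ∏ i ∈ s, y i ^ A i) ^ (n + 1)) / (n + 1 : E)) =
      ∑ i ∈ s, (A i : E) * ∑' n : ℕ, -((1 - y i) ^ (n + 1)) / (n + 1 : E) := by
  rw [logSeries_prod (ℓ := ℓ) s (fun i => y i ^ A i)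
    (fun i hi => IwasawaLog.norm_one_sub_pow_lt (hy i hi) _)]
  refine Finset.sum_congr rfl fun i hi => ?_
  exact IwasawaLog.logSeries_pow (p := ℓ) (hy i hi) (A i)

omit [CompleteSpace E] in
/-- **Continuity estimate** `‖L(y) - L(y')‖ ≤ ‖y - y'‖` for principal units with
`‖1 - y‖, ‖1 - y'‖ ≤ 1/2`... stated through the quotient: `‖L(y) - L(y')‖ ≤ ‖1 - y/y'‖` when
`‖1 - y/y'‖ ≤ 1/2`. [folklore] -/
theorem norm_logSeries_sub_le [CompleteSpace E] {y y' : E} (hy : ‖1 - y‖ < 1) (hy' : ‖1 - y'‖ < 1)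
    (hq : ‖1 - y / y'‖ ≤ 1 / 2) :
    ‖(∑' n : ℕ, -((1 - y) ^ (n + 1)) / (n + 1 : E)) -
        ∑' n : ℕ, -((1 - y') ^ (n + 1)) / (n + 1 : E)‖ ≤ ‖1 - y / y'‖ := by
  rw [← logSeries_div (ℓ := ℓ) hy hy']
  exact norm_logSeries_le (ℓ := ℓ) hq

/-- **Injectivity near `1`**: `L(y) = L(y')` with `‖1 - y‖, ‖1 - y'‖ ≤ 1/4` forces `y = y'`.
[folklore] -/
theorem eq_of_logSeries_eq {y y' : E} (hy : ‖1 - y‖ ≤ 1 / 4) (hy' : ‖1 - y'‖ ≤ 1 / 4)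
    (h : (∑' n : ℕ, -((1 - y) ^ (n + 1)) / (n + 1 : E)) =
      ∑' n : ℕ, -((1 - y') ^ (n + 1)) / (n + 1 : E)) : y = y' := by
  have hy1 : ‖1 - y‖ < 1 := hy.trans_lt (by norm_num)
  have hy1' : ‖1 - y'‖ < 1 := hy'.trans_lt (by norm_num)
  have hny' : ‖y'‖ = 1 := IwasawaLog.norm_eq_one_of_norm_one_sub_lt hy1'
  have hy0' : y' ≠ 0 := norm_pos_iff.mp (by rw [hny']; exact one_pos)
  -- `‖1 - y/y'‖ ≤ 1/4`
  have hq : ‖1 - y / y'‖ ≤ 1 / 4 := by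
    have e : 1 - y / y' = ((1 - y) - (1 - y')) / y' := by field_simp; ring
    rw [e, norm_div, hny', div_one, sub_eq_add_neg (1 - y)]
    refine (IsUltrametricDist.norm_add_le_max _ _).trans (max_le hy ?_)
    rw [norm_neg]; exact hy'
  have h0 : (∑' n : ℕ, -((1 - y / y') ^ (n + 1)) / (n + 1 : E)) = 0 := by
    rw [logSeries_div (ℓ := ℓ) hy1 hy1', h, sub_self]
  have hiso := norm_logSeries_eq (ℓ := ℓ) hq
  rw [h0, norm_zero] at hiso
  have : 1 - y / y' = 0 := norm_eq_zero.mp hiso.symm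
  rw [sub_eq_zero] at this
  rw [eq_div_iff hy0'] at this
  rw [← this, one_mul]

end LogE

end Literature.NumberTheory.GaloisRepresentations

end PartA0

section PartA1
open scoped NumberField
open NumberField IsDedekindDomain IsDedekindDomain.HeightOneSpectrum Finset

namespace Literature.NumberTheory.GaloisRepresentations

namespace Cong

variable {K : Type} [Field K] [NumberField K] {ℓ : ℕ} [Fact ℓ.Prime]

/-! ### The congruence predicate `x ≡ 0 [ℓ^j]` := `∀ v ∣ ℓ, |x|_v ≤ |ℓ^j|_v` (spelled out) -/

omit [Fact ℓ.Prime] in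
/-- `|ℓ|_v ≤ 1`. [folklore] -/
theorem valuation_ell_le_one (v : HeightOneSpectrum (𝓞 K)) : v.valuation K (ℓ : K) ≤ 1 := by
  rw [show (ℓ : K) = algebraMap (𝓞 K) K (ℓ : 𝓞 K) by simp]
  exact valuation_le_one v _

omit [Fact ℓ.Prime] in
/-- `|ℓ|_v < 1` at a place above `ℓ`. [folklore] -/
theorem valuation_ell_lt_one {v : HeightOneSpectrum (𝓞 K)} (hv : (ℓ : 𝓞 K) ∈ v.asIdeal) :
    v.valuation K (ℓ : K) < 1 := by
  rw [show (ℓ : K) = algebraMap (𝓞 K) K (ℓ : 𝓞 K) by simp, valuation_lt_one_iff_mem]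
  exact hv

omit [Fact ℓ.Prime] in
/-- Sums. [folklore] -/
theorem add {j : ℕ} {x y : K}
    (hx : ∀ v : HeightOneSpectrum (𝓞 K), (ℓ : 𝓞 K) ∈ v.asIdeal →
      v.valuation K x ≤ v.valuation K ((ℓ : K) ^ j))
    (hy : ∀ v : HeightOneSpectrum (𝓞 K), (ℓ : 𝓞 K) ∈ v.asIdeal →
      v.valuation K y ≤ v.valuation K ((ℓ : K) ^ j)) :
    ∀ v : HeightOneSpectrum (𝓞 K), (ℓ : 𝓞 K) ∈ v.asIdeal →
      v.valuation K (x + y) ≤ v.valuation K ((ℓ : K) ^ j) :=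
  fun v hv => (Valuation.map_add _ x y).trans (max_le (hx v hv) (hy v hv))

omit [Fact ℓ.Prime] in
/-- Negation. [folklore] -/
theorem neg {j : ℕ} {x : K}
    (hx : ∀ v : HeightOneSpectrum (𝓞 K), (ℓ : 𝓞 K) ∈ v.asIdeal →
      v.valuation K x ≤ v.valuation K ((ℓ : K) ^ j)) :
    ∀ v : HeightOneSpectrum (𝓞 K), (ℓ : 𝓞 K) ∈ v.asIdeal →
      v.valuation K (-x) ≤ v.valuation K ((ℓ : K) ^ j) :=
  fun v hv => by rw [Valuation.map_neg]; exact hx v hv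

omit [Fact ℓ.Prime] in
/-- Differences. [folklore] -/
theorem sub {j : ℕ} {x y : K}
    (hx : ∀ v : HeightOneSpectrum (𝓞 K), (ℓ : 𝓞 K) ∈ v.asIdeal →
      v.valuation K x ≤ v.valuation K ((ℓ : K) ^ j))
    (hy : ∀ v : HeightOneSpectrum (𝓞 K), (ℓ : 𝓞 K) ∈ v.asIdeal →
      v.valuation K y ≤ v.valuation K ((ℓ : K) ^ j)) :
    ∀ v : HeightOneSpectrum (𝓞 K), (ℓ : 𝓞 K) ∈ v.asIdeal →
      v.valuation K (x - y) ≤ v.valuation K ((ℓ : K) ^ j) := by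
  rw [sub_eq_add_neg]; exact add hx (neg hy)

omit [Fact ℓ.Prime] in
/-- Finite sums. [folklore] -/
theorem sum {j : ℕ} {ι : Type*} (s : Finset ι) (f : ι → K)
    (h : ∀ i ∈ s, ∀ v : HeightOneSpectrum (𝓞 K), (ℓ : 𝓞 K) ∈ v.asIdeal →
      v.valuation K (f i) ≤ v.valuation K ((ℓ : K) ^ j)) :
    ∀ v : HeightOneSpectrum (𝓞 K), (ℓ : 𝓞 K) ∈ v.asIdeal →
      v.valuation K (∑ i ∈ s, f i) ≤ v.valuation K ((ℓ : K) ^ j) :=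
  fun v hv => Valuation.map_sum_le _ fun i hi => h i hi v hv

omit [Fact ℓ.Prime] in
/-- Products. [folklore] -/
theorem mul {i j : ℕ} {x y : K}
    (hx : ∀ v : HeightOneSpectrum (𝓞 K), (ℓ : 𝓞 K) ∈ v.asIdeal →
      v.valuation K x ≤ v.valuation K ((ℓ : K) ^ i))
    (hy : ∀ v : HeightOneSpectrum (𝓞 K), (ℓ : 𝓞 K) ∈ v.asIdeal →
      v.valuation K y ≤ v.valuation K ((ℓ : K) ^ j)) :
    ∀ v : HeightOneSpectrum (𝓞 K), (ℓ : 𝓞 K) ∈ v.asIdeal →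
      v.valuation K (x * y) ≤ v.valuation K ((ℓ : K) ^ (i + j)) := by
  intro v hv
  rw [Valuation.map_mul, pow_add, Valuation.map_mul]
  exact mul_le_mul' (hx v hv) (hy v hv)

omit [Fact ℓ.Prime] in
/-- Weakening the level. [folklore] -/
theorem mono {i j : ℕ} {x : K}
    (hx : ∀ v : HeightOneSpectrum (𝓞 K), (ℓ : 𝓞 K) ∈ v.asIdeal →
      v.valuation K x ≤ v.valuation K ((ℓ : K) ^ j)) (hij : i ≤ j) :
    ∀ v : HeightOneSpectrum (𝓞 K), (ℓ : 𝓞 K) ∈ v.asIdeal →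
      v.valuation K x ≤ v.valuation K ((ℓ : K) ^ i) := by
  intro v hv
  refine (hx v hv).trans ?_
  rw [Valuation.map_pow, Valuation.map_pow]
  exact pow_le_pow_right_of_le_one' (valuation_ell_le_one v) hij

omit [Fact ℓ.Prime] in
/-- Algebraic integers are `ℓ`-integral. [folklore] -/
theorem zero_coe (z : 𝓞 K) :
    ∀ v : HeightOneSpectrum (𝓞 K), (ℓ : 𝓞 K) ∈ v.asIdeal →
      v.valuation K (z : K) ≤ v.valuation K ((ℓ : K) ^ 0) := by
  intro v _
  rw [pow_zero, Valuation.map_one]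
  exact valuation_le_one v z

omit [Fact ℓ.Prime] in
/-- Natural numbers are `ℓ`-integral. [folklore] -/
theorem zero_natCast (n : ℕ) :
    ∀ v : HeightOneSpectrum (𝓞 K), (ℓ : 𝓞 K) ∈ v.asIdeal →
      v.valuation K (n : K) ≤ v.valuation K ((ℓ : K) ^ 0) := by
  have := zero_coe (K := K) (ℓ := ℓ) (n : 𝓞 K)
  simpa using this

omit [Fact ℓ.Prime] in
/-- Integers are `ℓ`-integral. [folklore] -/
theorem zero_intCast (n : ℤ) :
    ∀ v : HeightOneSpectrum (𝓞 K), (ℓ : 𝓞 K) ∈ v.asIdeal →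
      v.valuation K (n : K) ≤ v.valuation K ((ℓ : K) ^ 0) := by
  have := zero_coe (K := K) (ℓ := ℓ) (n : 𝓞 K)
  simpa using this

omit [Fact ℓ.Prime] in
/-- `ℓ^j ≡ 0 [ℓ^j]`. [folklore] -/
theorem pow_self (j : ℕ) :
    ∀ v : HeightOneSpectrum (𝓞 K), (ℓ : 𝓞 K) ∈ v.asIdeal →
      v.valuation K ((ℓ : K) ^ j) ≤ v.valuation K ((ℓ : K) ^ j) := fun _ _ => le_rfl

omit [Fact ℓ.Prime] in
/-- An integer divisible by `ℓ` is `≡ 0 [ℓ]`. [folklore] -/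
theorem one_intCast_of_dvd {n : ℤ} (h : (ℓ : ℤ) ∣ n) :
    ∀ v : HeightOneSpectrum (𝓞 K), (ℓ : 𝓞 K) ∈ v.asIdeal →
      v.valuation K (n : K) ≤ v.valuation K ((ℓ : K) ^ 1) := by
  obtain ⟨q, rfl⟩ := h
  have := mul (pow_self (K := K) (ℓ := ℓ) 1) (zero_intCast (K := K) (ℓ := ℓ) q)
  simpa using this

omit [Fact ℓ.Prime] in
/-- `P ≡ 1 [ℓ^s]` with `s ≥ 1` makes `P` an `ℓ`-unit. [folklore] -/
theorem valuation_eq_one_of_sub_one {s : ℕ} (hs : 1 ≤ s) {P : K}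
    (hP : ∀ v : HeightOneSpectrum (𝓞 K), (ℓ : 𝓞 K) ∈ v.asIdeal →
      v.valuation K (P - 1) ≤ v.valuation K ((ℓ : K) ^ s)) :
    ∀ v : HeightOneSpectrum (𝓞 K), (ℓ : 𝓞 K) ∈ v.asIdeal → v.valuation K P = 1 := by
  intro v hv
  have hlt : v.valuation K (P - 1) < 1 := by
    refine (hP v hv).trans_lt ?_
    rw [Valuation.map_pow]
    exact pow_lt_one' (valuation_ell_lt_one hv) (by omega)
  have := Valuation.map_one_add_of_lt (v.valuation K) hlt
  rwa [add_sub_cancel] at this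

omit [Fact ℓ.Prime] in
/-- `P ≡ 1 [ℓ^s]`, `s ≥ 1` ⇒ `P` is `ℓ`-integral. [folklore] -/
theorem zero_of_sub_one {s : ℕ} (hs : 1 ≤ s) {P : K}
    (hP : ∀ v : HeightOneSpectrum (𝓞 K), (ℓ : 𝓞 K) ∈ v.asIdeal →
      v.valuation K (P - 1) ≤ v.valuation K ((ℓ : K) ^ s)) :
    ∀ v : HeightOneSpectrum (𝓞 K), (ℓ : 𝓞 K) ∈ v.asIdeal →
      v.valuation K P ≤ v.valuation K ((ℓ : K) ^ 0) := by
  intro v hv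
  rw [valuation_eq_one_of_sub_one hs hP v hv, pow_zero, Valuation.map_one]

omit [Fact ℓ.Prime] in
/-- `P ≡ 1 [ℓ^s]`, `s ≥ 1` ⇒ `P⁻¹` is `ℓ`-integral. [folklore] -/
theorem zero_inv_of_sub_one {s : ℕ} (hs : 1 ≤ s) {P : K}
    (hP : ∀ v : HeightOneSpectrum (𝓞 K), (ℓ : 𝓞 K) ∈ v.asIdeal →
      v.valuation K (P - 1) ≤ v.valuation K ((ℓ : K) ^ s)) :
    ∀ v : HeightOneSpectrum (𝓞 K), (ℓ : 𝓞 K) ∈ v.asIdeal →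
      v.valuation K P⁻¹ ≤ v.valuation K ((ℓ : K) ^ 0) := by
  intro v hv
  rw [Valuation.map_inv, valuation_eq_one_of_sub_one hs hP v hv, pow_zero, Valuation.map_one,
    inv_one]

omit [Fact ℓ.Prime] in
/-- Products of elements `≡ 1 [ℓ^s]` are `≡ 1 [ℓ^s]`. [folklore] -/
theorem prod_sub_one {s : ℕ} {ι : Type*} (S : Finset ι) (u : ι → K)
    (hu : ∀ i ∈ S, ∀ v : HeightOneSpectrum (𝓞 K), (ℓ : 𝓞 K) ∈ v.asIdeal →
      v.valuation K (u i - 1) ≤ v.valuation K ((ℓ : K) ^ s)) :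
    ∀ v : HeightOneSpectrum (𝓞 K), (ℓ : 𝓞 K) ∈ v.asIdeal →
      v.valuation K (∏ i ∈ S, u i - 1) ≤ v.valuation K ((ℓ : K) ^ s) := by
  classical
  induction S using Finset.induction_on with
  | empty => intro v _; simp
  | insert a S ha ih =>
    have ih' := ih fun i hi => hu i (Finset.mem_insert_of_mem hi)
    have hua := hu a (Finset.mem_insert_self a S)
    rw [Finset.prod_insert ha,
      show u a * ∏ i ∈ S, u i - 1 = (u a - 1) * ∏ i ∈ S, u i + (∏ i ∈ S, u i - 1) by ring]
    refine add ?_ ih'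
    -- `(u a - 1) · ∏` with `∏` integral
    have hint : ∀ v : HeightOneSpectrum (𝓞 K), (ℓ : 𝓞 K) ∈ v.asIdeal →
        v.valuation K (∏ i ∈ S, u i) ≤ v.valuation K ((ℓ : K) ^ 0) := by
      intro v hv
      have h1 := ih' v hv
      rw [pow_zero, Valuation.map_one]
      have : ∏ i ∈ S, u i = (∏ i ∈ S, u i - 1) + 1 := by ring
      rw [this]
      refine (Valuation.map_add _ _ _).trans (max_le (h1.trans ?_) ?_)
      · rw [Valuation.map_pow]; exact pow_le_one' (valuation_ell_le_one v) _
      · rw [Valuation.map_one]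
    have := mul hua hint
    simpa using this

/-! ### Binomial congruences -/

omit [Fact ℓ.Prime] in
/-- `(1 + z)^n = 1 + n z + z² w` with `w` `ℓ`-integral when `z` is. [folklore] -/
theorem exists_one_add_pow {z : K}
    (hz : ∀ v : HeightOneSpectrum (𝓞 K), (ℓ : 𝓞 K) ∈ v.asIdeal →
      v.valuation K z ≤ v.valuation K ((ℓ : K) ^ 0)) (n : ℕ) :
    ∃ w : K, (∀ v : HeightOneSpectrum (𝓞 K), (ℓ : 𝓞 K) ∈ v.asIdeal →
      v.valuation K w ≤ v.valuation K ((ℓ : K) ^ 0)) ∧ (1 + z) ^ n = 1 + n * z + z ^ 2 * w := by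
  induction n with
  | zero => exact ⟨0, fun v _ => by simp, by simp⟩
  | succ n ih =>
    obtain ⟨w, hw, hpow⟩ := ih
    refine ⟨n + w + z * w, ?_, ?_⟩
    · have h1 := add (add (zero_natCast (K := K) (ℓ := ℓ) n) hw) (mul hz hw)
      simpa using h1
    · rw [pow_succ, hpow]; push_cast; ring

omit [Fact ℓ.Prime] in
/-- **The `ℓ`-power tower**: for `y ≡ 0 [ℓ^s]`, `s ≥ 2`:
`(1 + y)^{ℓ^r} ≡ 1 + ℓ^r y [ℓ^{r+s+1}]`. [folklore] -/
theorem pow_prime_pow_sub {s : ℕ} (hs : 2 ≤ s) {y : K}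
    (hy : ∀ v : HeightOneSpectrum (𝓞 K), (ℓ : 𝓞 K) ∈ v.asIdeal →
      v.valuation K y ≤ v.valuation K ((ℓ : K) ^ s)) (r : ℕ) :
    ∀ v : HeightOneSpectrum (𝓞 K), (ℓ : 𝓞 K) ∈ v.asIdeal →
      v.valuation K ((1 + y) ^ (ℓ ^ r) - 1 - (ℓ : K) ^ r * y) ≤
        v.valuation K ((ℓ : K) ^ (r + s + 1)) := by
  induction r with
  | zero => intro v _; simp
  | succ r ih =>
    -- `z_r = (1+y)^{ℓ^r} - 1 ≡ 0 [ℓ^{r+s}]`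
    set z : K := (1 + y) ^ (ℓ ^ r) - 1 with hz
    have hry : ∀ v : HeightOneSpectrum (𝓞 K), (ℓ : 𝓞 K) ∈ v.asIdeal →
        v.valuation K ((ℓ : K) ^ r * y) ≤ v.valuation K ((ℓ : K) ^ (r + s)) :=
      mul (pow_self (K := K) (ℓ := ℓ) r) hy
    have hzc : ∀ v : HeightOneSpectrum (𝓞 K), (ℓ : 𝓞 K) ∈ v.asIdeal →
        v.valuation K z ≤ v.valuation K ((ℓ : K) ^ (r + s)) := by
      have h1 : z = ((1 + y) ^ (ℓ ^ r) - 1 - (ℓ : K) ^ r * y) + (ℓ : K) ^ r * y := by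
        rw [hz]; ring
      rw [h1]
      exact add (mono ih (by omega)) hry
    have hz0 := mono hzc (Nat.zero_le _)
    obtain ⟨w, hw, hpow⟩ := exists_one_add_pow hz0 ℓ
    -- `(1+y)^{ℓ^{r+1}} = (1 + z)^ℓ = 1 + ℓ z + z² w`
    have hid : (1 + y) ^ (ℓ ^ (r + 1)) - 1 - (ℓ : K) ^ (r + 1) * y =
        (ℓ : K) * ((1 + y) ^ (ℓ ^ r) - 1 - (ℓ : K) ^ r * y) + z ^ 2 * w := by
      have e1 : (1 + y) ^ (ℓ ^ (r + 1)) = (1 + z) ^ ℓ := by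
        rw [hz, add_sub_cancel, ← pow_mul, ← pow_succ]
      rw [e1, hpow, hz]; ring
    intro v hv
    rw [hid]
    refine add ?_ ?_ v hv
    · have := mul (pow_self (K := K) (ℓ := ℓ) 1) ih
      rw [pow_one] at this
      exact mono this (by omega)
    · have := mul (mul hzc hzc) hw
      rw [← pow_two] at this
      exact mono this (by omega)

omit [Fact ℓ.Prime] in
/-- `(1 + y)^{ℓ^r a} ≡ 1 + a ℓ^r y [ℓ^{r+s+1}]` for `y ≡ 0 [ℓ^s]`, `s ≥ 2`, `a ∈ ℕ`. [folklore] -/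
theorem pow_prime_pow_mul_sub {s : ℕ} (hs : 2 ≤ s) {y : K}
    (hy : ∀ v : HeightOneSpectrum (𝓞 K), (ℓ : 𝓞 K) ∈ v.asIdeal →
      v.valuation K y ≤ v.valuation K ((ℓ : K) ^ s)) (r a : ℕ) :
    ∀ v : HeightOneSpectrum (𝓞 K), (ℓ : 𝓞 K) ∈ v.asIdeal →
      v.valuation K ((1 + y) ^ (ℓ ^ r * a) - 1 - (a : K) * ((ℓ : K) ^ r * y)) ≤
        v.valuation K ((ℓ : K) ^ (r + s + 1)) := by
  set z : K := (1 + y) ^ (ℓ ^ r) - 1 with hz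
  have htow := pow_prime_pow_sub hs hy r
  have hry : ∀ v : HeightOneSpectrum (𝓞 K), (ℓ : 𝓞 K) ∈ v.asIdeal →
      v.valuation K ((ℓ : K) ^ r * y) ≤ v.valuation K ((ℓ : K) ^ (r + s)) :=
    mul (pow_self (K := K) (ℓ := ℓ) r) hy
  have hzc : ∀ v : HeightOneSpectrum (𝓞 K), (ℓ : 𝓞 K) ∈ v.asIdeal →
      v.valuation K z ≤ v.valuation K ((ℓ : K) ^ (r + s)) := by
    have h1 : z = ((1 + y) ^ (ℓ ^ r) - 1 - (ℓ : K) ^ r * y) + (ℓ : K) ^ r * y := by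
      rw [hz]; ring
    rw [h1]
    exact add (mono htow (by omega)) hry
  obtain ⟨w, hw, hpow⟩ := exists_one_add_pow (mono hzc (Nat.zero_le _)) a
  have hid : (1 + y) ^ (ℓ ^ r * a) - 1 - (a : K) * ((ℓ : K) ^ r * y) =
      (a : K) * ((1 + y) ^ (ℓ ^ r) - 1 - (ℓ : K) ^ r * y) + z ^ 2 * w := by
    rw [pow_mul, show (1 + y) ^ ℓ ^ r = 1 + z by rw [hz, add_sub_cancel], hpow, hz]; ring
  intro v hv
  rw [hid]
  refine add ?_ ?_ v hv
  · have := mul (zero_natCast (K := K) (ℓ := ℓ) a) htow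
    rw [zero_add] at this
    exact this
  · have := mul (mul hzc hzc) hw
    rw [← pow_two] at this
    exact mono this (by omega)

omit [Fact ℓ.Prime] in
/-- **Monomials**: `∏ᵢ (1 + yᵢ)^{ℓ^r aᵢ} = 1 + ℓ^r ∑ᵢ aᵢ yᵢ + e` with `e ≡ 0 [ℓ^{r+s+1}]`, for
`yᵢ ≡ 0 [ℓ^s]`, `s ≥ 2`. [folklore] -/
theorem exists_prod_pow_eq {s : ℕ} (hs : 2 ≤ s) {ι : Type*} (S : Finset ι) (y : ι → K)
    (hy : ∀ i ∈ S, ∀ v : HeightOneSpectrum (𝓞 K), (ℓ : 𝓞 K) ∈ v.asIdeal →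
      v.valuation K (y i) ≤ v.valuation K ((ℓ : K) ^ s)) (r : ℕ) (a : ι → ℕ) :
    ∃ e : K, (∀ v : HeightOneSpectrum (𝓞 K), (ℓ : 𝓞 K) ∈ v.asIdeal →
      v.valuation K e ≤ v.valuation K ((ℓ : K) ^ (r + s + 1))) ∧
      ∏ i ∈ S, (1 + y i) ^ (ℓ ^ r * a i) = 1 + (ℓ : K) ^ r * ∑ i ∈ S, (a i : K) * y i + e := by
  classical
  induction S using Finset.induction_on with
  | empty => exact ⟨0, fun v _ => by simp, by simp⟩
  | insert j S hj ih =>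
    obtain ⟨e, he, hprod⟩ := ih fun i hi => hy i (Finset.mem_insert_of_mem hi)
    have hyj := hy j (Finset.mem_insert_self j S)
    -- the new factor `g = 1 + m_j + e_j`
    set ej : K := (1 + y j) ^ (ℓ ^ r * a j) - 1 - (a j : K) * ((ℓ : K) ^ r * y j) with hej
    have hejc := pow_prime_pow_mul_sub hs hyj r (a j)
    set mS : K := (ℓ : K) ^ r * ∑ i ∈ S, (a i : K) * y i with hmS
    set mj : K := (a j : K) * ((ℓ : K) ^ r * y j) with hmj
    have hmSc : ∀ v : HeightOneSpectrum (𝓞 K), (ℓ : 𝓞 K) ∈ v.asIdeal →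
        v.valuation K mS ≤ v.valuation K ((ℓ : K) ^ (r + s)) := by
      refine mul (pow_self (K := K) (ℓ := ℓ) r) (sum S _ fun i hi => ?_)
      have := mul (zero_natCast (K := K) (ℓ := ℓ) (a i)) (hy i (Finset.mem_insert_of_mem hi))
      rwa [zero_add] at this
    have hmjc : ∀ v : HeightOneSpectrum (𝓞 K), (ℓ : 𝓞 K) ∈ v.asIdeal →
        v.valuation K mj ≤ v.valuation K ((ℓ : K) ^ (r + s)) := by
      have := mul (zero_natCast (K := K) (ℓ := ℓ) (a j)) (mul (pow_self (K := K) (ℓ := ℓ) r) hyj)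
      rwa [zero_add] at this
    refine ⟨e + ej + (mS + e) * (mj + ej), ?_, ?_⟩
    · refine add (add he hejc) ?_
      have h1 := mul (add hmSc (mono he (by omega))) (add hmjc (mono hejc (by omega)))
      exact mono h1 (by omega)
    · rw [Finset.prod_insert hj, Finset.sum_insert hj, hprod,
        show (1 + y j) ^ (ℓ ^ r * a j) = 1 + mj + ej by rw [hej, hmj]; ring, hmS, hmj]
      ring

/-! ### `ℓ`-integral elements: denominators prime to `ℓ`, residues modulo `ℓ` -/

/-- An `ℓ`-integral `x ∈ K` has a denominator prime to `ℓ`: `t x ∈ 𝓞_K` with `ℓ ∤ t`.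
[folklore] -/
theorem exists_natCast_mul_eq_coe {x : K}
    (hx : ∀ v : HeightOneSpectrum (𝓞 K), (ℓ : 𝓞 K) ∈ v.asIdeal →
      v.valuation K x ≤ v.valuation K ((ℓ : K) ^ 0)) :
    ∃ t : ℕ, ¬ ℓ ∣ t ∧ ∃ z : 𝓞 K, (t : K) * x = z := by
  classical
  have hℓ : ℓ.Prime := Fact.out
  obtain ⟨a, d, hd, hadz⟩ := IsFractionRing.div_surjective (A := 𝓞 K) x
  have hd' : (d : K) ≠ 0 := by exact_mod_cast nonZeroDivisors.ne_zero hd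
  have hdz : (d : K) * x = a := by rw [← hadz]; field_simp
  set t : ℕ := Ideal.absNorm (Ideal.span {(d : 𝓞 K)}) with htdef
  have htmem : (t : 𝓞 K) ∈ Ideal.span {(d : 𝓞 K)} := Ideal.absNorm_mem _
  obtain ⟨dt, hdt⟩ := Ideal.mem_span_singleton'.mp htmem
  have ht0 : t ≠ 0 := by
    rw [htdef, Ne, Ideal.absNorm_eq_zero_iff, Ideal.span_singleton_eq_bot]
    exact nonZeroDivisors.ne_zero hd
  obtain ⟨r, t', ht', htt'⟩ := Nat.exists_eq_pow_mul_and_not_dvd ht0 ℓ hℓ.ne_one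
  have hint : ∀ v : HeightOneSpectrum (𝓞 K), v.valuation K ((t' : K) * x) ≤ 1 := by
    intro v
    by_cases hv : (ℓ : 𝓞 K) ∈ v.asIdeal
    · have ht'v : v.valuation K (t' : K) = 1 := by
        rw [show (t' : K) = algebraMap (𝓞 K) K (t' : 𝓞 K) by simp, valuation_eq_one_iff_notMem]
        exact FramedGaloisRep.natCast_not_mem_of_not_dvd hℓ hv ht'
      rw [map_mul, ht'v, one_mul]
      have := hx v hv
      rwa [pow_zero, Valuation.map_one] at this
    · have hℓv : v.valuation K (ℓ : K) = 1 := by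
        rw [show (ℓ : K) = algebraMap (𝓞 K) K (ℓ : 𝓞 K) by simp, valuation_eq_one_iff_notMem]
        exact hv
      have htz : v.valuation K ((t : K) * x) ≤ 1 := by
        have e1 : (t : K) * x = ((dt * a : 𝓞 K) : K) := by
          have : (t : K) = ((dt * d : 𝓞 K) : K) := by rw [hdt]; simp
          rw [this]; push_cast; rw [mul_assoc, hdz]
        rw [e1, show ((dt * a : 𝓞 K) : K) = algebraMap (𝓞 K) K (dt * a) from rfl]
        exact valuation_le_one v _
      have e2 : (t' : K) * x = (t : K) * x * ((ℓ : K) ^ r)⁻¹ := by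
        have hℓ0 : (ℓ : K) ≠ 0 := by exact_mod_cast hℓ.ne_zero
        rw [htt']; push_cast; field_simp
      rw [e2, map_mul, map_inv₀, map_pow, hℓv, one_pow, inv_one, mul_one]
      exact htz
  obtain ⟨z, hz⟩ := mem_integers_of_valuation_le_one K ((t' : K) * x) hint
  exact ⟨t', ht', z, hz.symm⟩

/-- **Residues modulo `ℓ`**: every `ℓ`-integral `x ∈ K` is `≡ ∑ aᵢ bᵢ [ℓ]` for natural numbers
`aᵢ`, `(bᵢ)` a `ℤ`-basis of `𝓞_K`. [folklore] -/
theorem exists_sub_sum_natCast_mul {ι' : Type*} [Fintype ι'] (b : Module.Basis ι' ℤ (𝓞 K)) {x : K}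
    (hx : ∀ v : HeightOneSpectrum (𝓞 K), (ℓ : 𝓞 K) ∈ v.asIdeal →
      v.valuation K x ≤ v.valuation K ((ℓ : K) ^ 0)) :
    ∃ a : ι' → ℕ, ∀ v : HeightOneSpectrum (𝓞 K), (ℓ : 𝓞 K) ∈ v.asIdeal →
      v.valuation K (x - ∑ i, (a i : K) * (b i : K)) ≤ v.valuation K ((ℓ : K) ^ 1) := by
  classical
  have hℓ : ℓ.Prime := Fact.out
  obtain ⟨t, ht, z, htx⟩ := exists_natCast_mul_eq_coe hx
  -- `t'' t ≡ 1 mod ℓ`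
  have hcop : Nat.Coprime t ℓ := (Nat.Prime.coprime_iff_not_dvd hℓ).mpr ht |>.symm
  obtain ⟨t'', -, htt''⟩ := Nat.exists_mul_mod_eq_one_of_coprime hcop hℓ.one_lt
  -- `z = ∑ cᵢ bᵢ`
  set c : ι' → ℤ := fun i => b.repr z i with hc
  have hz : (z : K) = ∑ i, (c i : K) * (b i : K) := by
    have h1 := b.sum_repr z
    have h2 := congrArg (fun w : 𝓞 K => (w : K)) h1
    rw [← h2]
    push_cast
    simp [hc, zsmul_eq_mul]
  -- the digits `aᵢ = (t'' cᵢ) mod ℓ`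
  refine ⟨fun i => (((t'' : ℤ) * c i) % ℓ).toNat, ?_⟩
  have hdig : ∀ i, ∃ q : ℤ, ((t'' : ℤ) * c i : ℤ) = ℓ * q + ((((t'' : ℤ) * c i) % ℓ).toNat : ℤ) := by
    intro i
    refine ⟨((t'' : ℤ) * c i) / ℓ, ?_⟩
    rw [Int.toNat_of_nonneg (Int.emod_nonneg _ (by exact_mod_cast hℓ.ne_zero))]
    have := Int.mul_ediv_add_emod ((t'' : ℤ) * c i) ℓ
    linarith
  choose q hq using hdig
  -- `1 - t t'' = -ℓ q₀`
  obtain ⟨q₀, hq₀⟩ : ∃ q₀ : ℤ, (1 : ℤ) - t * t'' = ℓ * q₀ := by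
    have h1 : ((t * t'' : ℕ) : ℤ) % ℓ = 1 := by exact_mod_cast htt''
    refine ⟨-((t * t'' : ℤ) / ℓ), ?_⟩
    have h2 := Int.mul_ediv_add_emod ((t : ℤ) * t'') ℓ
    push_cast at h1
    rw [h1] at h2
    linarith
  -- the identity
  have e1 : ∀ i, (((((t'' : ℤ) * c i) % ℓ).toNat : ℕ) : K) = ((t'' : ℤ) * c i : ℤ) - (ℓ * q i : ℤ) := by
    intro i
    have := hq i
    have : (((((t'' : ℤ) * c i) % ℓ).toNat : ℕ) : ℤ) = (t'' : ℤ) * c i - ℓ * q i := by linarith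
    exact_mod_cast congrArg (fun w : ℤ => (w : K)) this
  have hid : x - ∑ i, (((((t'' : ℤ) * c i) % ℓ).toNat : ℕ) : K) * (b i : K) =
      ((1 - t * t'' : ℤ) : K) * x + ∑ i, ((ℓ * q i : ℤ) : K) * (b i : K) := by
    have e3 : ∑ i, (((((t'' : ℤ) * c i) % ℓ).toNat : ℕ) : K) * (b i : K) =
        (t'' : K) * (z : K) - ∑ i, ((ℓ * q i : ℤ) : K) * (b i : K) := by
      rw [hz, Finset.mul_sum, ← Finset.sum_sub_distrib]
      refine Finset.sum_congr rfl fun i _ => ?_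
      rw [e1 i]; push_cast; ring
    rw [e3, ← htx]; push_cast; ring
  rw [hid]
  refine add ?_ (sum _ _ fun i _ => ?_)
  · have := mul (one_intCast_of_dvd (K := K) (ℓ := ℓ) ⟨q₀, hq₀⟩) hx
    simpa using this
  · have := mul (one_intCast_of_dvd (K := K) (ℓ := ℓ) ⟨q i, rfl⟩) (zero_coe (K := K) (ℓ := ℓ) (b i))
    simpa using this

/-! ### Successive approximation by monomials in `γᵢ = 1 + ℓ^s bᵢ` -/

omit [Fact ℓ.Prime] in
/-- Powers of an element `≡ 1 [ℓ^s]` are `≡ 1 [ℓ^s]`. [folklore] -/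
theorem pow_sub_one {s : ℕ} {u : K}
    (hu : ∀ v : HeightOneSpectrum (𝓞 K), (ℓ : 𝓞 K) ∈ v.asIdeal →
      v.valuation K (u - 1) ≤ v.valuation K ((ℓ : K) ^ s)) (m : ℕ) :
    ∀ v : HeightOneSpectrum (𝓞 K), (ℓ : 𝓞 K) ∈ v.asIdeal →
      v.valuation K (u ^ m - 1) ≤ v.valuation K ((ℓ : K) ^ s) := by
  have := prod_sub_one (Finset.range m) (fun _ => u) fun _ _ => hu
  simpa using this

omit [Fact ℓ.Prime] in
/-- The generators `γᵢ = 1 + ℓ^s bᵢ` are `≡ 1 [ℓ^s]`. [folklore] -/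
theorem gen_sub_one {ι' : Type*} (b : ι' → 𝓞 K) (s : ℕ) (i : ι') :
    ∀ v : HeightOneSpectrum (𝓞 K), (ℓ : 𝓞 K) ∈ v.asIdeal →
      v.valuation K ((1 + (ℓ : K) ^ s * (b i : K)) - 1) ≤ v.valuation K ((ℓ : K) ^ s) := by
  have := mul (pow_self (K := K) (ℓ := ℓ) s) (zero_coe (K := K) (ℓ := ℓ) (b i))
  simpa using this

omit [Fact ℓ.Prime] in
/-- Monomials in the `γᵢ` are `≡ 1 [ℓ^s]`. [folklore] -/
theorem monomial_sub_one {ι' : Type*} [Fintype ι'] (b : ι' → 𝓞 K) (s : ℕ) (A : ι' → ℕ) :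
    ∀ v : HeightOneSpectrum (𝓞 K), (ℓ : 𝓞 K) ∈ v.asIdeal →
      v.valuation K (∏ i, (1 + (ℓ : K) ^ s * (b i : K)) ^ A i - 1) ≤
        v.valuation K ((ℓ : K) ^ s) :=
  prod_sub_one _ _ fun i _ => pow_sub_one (gen_sub_one b s i) (A i)

/-- **One approximation step**: if `k ≡ P [ℓ^j]` with `P ≡ 1 [ℓ^s]`, `2 ≤ s ≤ j`, then
`k ≡ P · ∏ᵢ γᵢ^{ℓ^{j-s} aᵢ} [ℓ^{j+1}]` for suitable `aᵢ ∈ ℕ`. [folklore] -/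
theorem exists_step {ι' : Type*} [Fintype ι'] (b : Module.Basis ι' ℤ (𝓞 K)) {s : ℕ} (hs : 2 ≤ s)
    {j : ℕ} (hj : s ≤ j) {k P : K}
    (hP : ∀ v : HeightOneSpectrum (𝓞 K), (ℓ : 𝓞 K) ∈ v.asIdeal →
      v.valuation K (P - 1) ≤ v.valuation K ((ℓ : K) ^ s))
    (hkP : ∀ v : HeightOneSpectrum (𝓞 K), (ℓ : 𝓞 K) ∈ v.asIdeal →
      v.valuation K (k - P) ≤ v.valuation K ((ℓ : K) ^ j)) :
    ∃ a : ι' → ℕ, ∀ v : HeightOneSpectrum (𝓞 K), (ℓ : 𝓞 K) ∈ v.asIdeal →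
      v.valuation K (k - P * ∏ i, (1 + (ℓ : K) ^ s * (b i : K)) ^ (ℓ ^ (j - s) * a i)) ≤
        v.valuation K ((ℓ : K) ^ (j + 1)) := by
  have hℓ : ℓ.Prime := Fact.out
  have hℓ0 : (ℓ : K) ≠ 0 := by exact_mod_cast hℓ.ne_zero
  -- `x = (k - P)/ℓ^j` is `ℓ`-integral
  obtain ⟨x, hxdef⟩ : ∃ x : K, x = (k - P) / (ℓ : K) ^ j := ⟨_, rfl⟩
  have hx0 : ∀ v : HeightOneSpectrum (𝓞 K), (ℓ : 𝓞 K) ∈ v.asIdeal →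
      v.valuation K x ≤ v.valuation K ((ℓ : K) ^ 0) := by
    intro v hv
    have hpow0 : v.valuation K ((ℓ : K) ^ j) ≠ 0 :=
      (Valuation.ne_zero_iff _).mpr (pow_ne_zero _ hℓ0)
    rw [pow_zero, Valuation.map_one, hxdef, map_div₀, div_le_one₀ (zero_lt_iff.mpr hpow0)]
    exact hkP v hv
  obtain ⟨a, ha⟩ := exists_sub_sum_natCast_mul b hx0
  refine ⟨a, ?_⟩
  -- the monomial `∏ (1 + yᵢ)^{ℓ^{j-s} aᵢ} = 1 + ℓ^{j-s} ∑ aᵢ yᵢ + e`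
  have hy : ∀ i ∈ (Finset.univ : Finset ι'), ∀ v : HeightOneSpectrum (𝓞 K),
      (ℓ : 𝓞 K) ∈ v.asIdeal →
      v.valuation K ((ℓ : K) ^ s * (b i : K)) ≤ v.valuation K ((ℓ : K) ^ s) := by
    intro i _
    have := mul (pow_self (K := K) (ℓ := ℓ) s) (zero_coe (K := K) (ℓ := ℓ) (b i))
    simpa using this
  obtain ⟨e, he, hprod⟩ := exists_prod_pow_eq hs Finset.univ (fun i => (ℓ : K) ^ s * (b i : K))
    hy (j - s) a
  have he' : ∀ v : HeightOneSpectrum (𝓞 K), (ℓ : 𝓞 K) ∈ v.asIdeal →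
      v.valuation K e ≤ v.valuation K ((ℓ : K) ^ (j + 1)) := by
    have : j - s + s + 1 = j + 1 := by omega
    rw [this] at he
    exact he
  -- the identity
  have hℓj : (ℓ : K) ^ (j - s) * (ℓ : K) ^ s = (ℓ : K) ^ j := by
    rw [← pow_add, Nat.sub_add_cancel hj]
  have hid : k - P * ∏ i, (1 + (ℓ : K) ^ s * (b i : K)) ^ (ℓ ^ (j - s) * a i) =
      (ℓ : K) ^ j * (x - ∑ i, (a i : K) * (b i : K)) +
        (ℓ : K) ^ j * ((1 - P) * ∑ i, (a i : K) * (b i : K)) - P * e := by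
    rw [hprod]
    have e1 : (ℓ : K) ^ (j - s) * ∑ i, (a i : K) * ((ℓ : K) ^ s * (b i : K)) =
        (ℓ : K) ^ j * ∑ i, (a i : K) * (b i : K) := by
      rw [← hℓj, Finset.mul_sum, Finset.mul_sum]
      refine Finset.sum_congr rfl fun i _ => ?_
      ring
    rw [e1]
    have e2 : (ℓ : K) ^ j * x = k - P := by
      rw [hxdef, mul_div_cancel₀ _ (pow_ne_zero _ hℓ0)]
    linear_combination -e2
  intro v hv
  rw [hid]
  refine sub (add ?_ ?_) ?_ v hv
  · exact mul (pow_self (K := K) (ℓ := ℓ) j) ha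
  · have h1P : ∀ v : HeightOneSpectrum (𝓞 K), (ℓ : 𝓞 K) ∈ v.asIdeal →
        v.valuation K (1 - P) ≤ v.valuation K ((ℓ : K) ^ 1) := by
      have := neg hP
      intro v hv
      have h := mono this (show 1 ≤ s by omega) v hv
      rwa [neg_sub] at h
    have hsum : ∀ v : HeightOneSpectrum (𝓞 K), (ℓ : 𝓞 K) ∈ v.asIdeal →
        v.valuation K (∑ i, (a i : K) * (b i : K)) ≤ v.valuation K ((ℓ : K) ^ 0) :=
      sum _ _ fun i _ => by
        have := mul (zero_natCast (K := K) (ℓ := ℓ) (a i)) (zero_coe (K := K) (ℓ := ℓ) (b i))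
        simpa using this
    have := mul (pow_self (K := K) (ℓ := ℓ) j) (mul h1P hsum)
    simpa using this
  · have := mul (zero_of_sub_one (show 1 ≤ s by omega) hP) he'
    simpa using this

/-- **Successive approximation**: every `k ≡ 1 [ℓ^s]` (`s ≥ 2`) is congruent modulo `ℓ^{s+n}`
to a monomial `∏ᵢ γᵢ^{Aᵢ}`, `γᵢ = 1 + ℓ^s bᵢ`, `Aᵢ ∈ ℕ`, for every `n`. [folklore] -/
theorem exists_monomial {ι' : Type*} [Fintype ι'] (b : Module.Basis ι' ℤ (𝓞 K)) {s : ℕ}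
    (hs : 2 ≤ s) (n : ℕ) {k : K}
    (hk : ∀ v : HeightOneSpectrum (𝓞 K), (ℓ : 𝓞 K) ∈ v.asIdeal →
      v.valuation K (k - 1) ≤ v.valuation K ((ℓ : K) ^ s)) :
    ∃ A : ι' → ℕ, ∀ v : HeightOneSpectrum (𝓞 K), (ℓ : 𝓞 K) ∈ v.asIdeal →
      v.valuation K (k - ∏ i, (1 + (ℓ : K) ^ s * (b i : K)) ^ A i) ≤
        v.valuation K ((ℓ : K) ^ (s + n)) := by
  induction n with
  | zero => exact ⟨0, by simpa using hk⟩
  | succ n ih =>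
    obtain ⟨A, hA⟩ := ih
    have hP := monomial_sub_one (K := K) (ℓ := ℓ) (fun i => b i) s A
    obtain ⟨a, ha⟩ := exists_step b hs (show s ≤ s + n by omega) hP hA
    refine ⟨fun i => A i + ℓ ^ n * a i, ?_⟩
    have hprod : ∏ i, (1 + (ℓ : K) ^ s * (b i : K)) ^ (A i + ℓ ^ n * a i) =
        (∏ i, (1 + (ℓ : K) ^ s * (b i : K)) ^ A i) *
          ∏ i, (1 + (ℓ : K) ^ s * (b i : K)) ^ (ℓ ^ (s + n - s) * a i) := by
      rw [← Finset.prod_mul_distrib]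
      refine Finset.prod_congr rfl fun i _ => ?_
      rw [← pow_add, show s + n - s = n by omega]
    rw [hprod, show s + (n + 1) = s + n + 1 by omega]
    exact ha

end Cong

end Literature.NumberTheory.GaloisRepresentations

end PartA1
section PartA2
open scoped NumberField
open NumberField Filter Topology Finset
open Literature.NumberTheory.Transcendental

namespace Literature.NumberTheory.GaloisRepresentations

namespace Expansion

variable {K : Type} [Field K] [NumberField K] {ℓ : ℕ} [Fact ℓ.Prime]

/-- **A `ℤ`-basis of `𝓞_K` indexed by the embeddings `K → ℚ̄_ℓ`, with invertible embedding
matrix** `(τ(b_σ))_{σ,τ}` (its determinant squares to the discriminant of `K`). [folklore] -/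
theorem exists_basis_det_ne_zero [DecidableEq (K →+* PadicAlgCl ℓ)] :
    ∃ bO : Module.Basis (K →+* PadicAlgCl ℓ) ℤ (𝓞 K),
      (Matrix.of fun σ τ : (K →+* PadicAlgCl ℓ) => τ ((bO σ : 𝓞 K) : K)).det ≠ 0 := by
  classical
  have hcard : Fintype.card (Module.Free.ChooseBasisIndex ℤ (𝓞 K)) =
      Fintype.card (K →+* PadicAlgCl ℓ) := by
    rw [← Module.finrank_eq_card_chooseBasisIndex, RingOfIntegers.rank, Embeddings.card]
  set e : Module.Free.ChooseBasisIndex ℤ (𝓞 K) ≃ (K →+* PadicAlgCl ℓ) :=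
    Fintype.equivOfCardEq hcard with he
  set bO : Module.Basis (K →+* PadicAlgCl ℓ) ℤ (𝓞 K) := (RingOfIntegers.basis K).reindex e
    with hbO
  refine ⟨bO, ?_⟩
  set bK : Module.Basis (K →+* PadicAlgCl ℓ) ℚ K := (integralBasis K).reindex e with hbK
  have hbK' : ∀ σ, bK σ = ((bO σ : 𝓞 K) : K) := by
    intro σ
    rw [hbK, hbO, Module.Basis.reindex_apply, Module.Basis.reindex_apply, integralBasis_apply]
  have hdisc := Algebra.discr_eq_det_embeddingsMatrixReindex_pow_two ℚ (PadicAlgCl ℓ) bK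
    (RingHom.equivRatAlgHom : (K →+* PadicAlgCl ℓ) ≃ (K →ₐ[ℚ] PadicAlgCl ℓ))
  have hne : Algebra.discr ℚ bK ≠ 0 := Algebra.discr_not_zero_of_basis ℚ bK
  have hdet : (Algebra.embeddingsMatrixReindex ℚ (PadicAlgCl ℓ) bK
      RingHom.equivRatAlgHom).det ≠ 0 := by
    intro h0
    rw [h0, zero_pow two_ne_zero, map_eq_zero] at hdisc
    exact hne hdisc
  have hmat : (Matrix.of fun σ τ : (K →+* PadicAlgCl ℓ) => τ ((bO σ : 𝓞 K) : K)) =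
      Algebra.embeddingsMatrixReindex ℚ (PadicAlgCl ℓ) bK RingHom.equivRatAlgHom := by
    ext σ τ
    simp only [Matrix.of_apply, Algebra.embeddingsMatrixReindex, Matrix.reindex_apply,
      Matrix.submatrix_apply, Equiv.symm_symm, Algebra.embeddingsMatrix_apply, hbK']
    rfl
  rw [hmat]
  exact hdet

variable {E : Type} [NontriviallyNormedField E] [NormedAlgebra ℚ_[ℓ] E] [IsUltrametricDist E]
  [CompleteSpace E]

omit [IsUltrametricDist E] [CompleteSpace E] in
/-- `‖(ℓ : E)^s‖ = ℓ^{-s}`. [folklore] -/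
theorem norm_ell_pow (s : ℕ) : ‖(ℓ : E) ^ s‖ = ((ℓ : ℝ)⁻¹) ^ s := by
  rw [norm_pow, PadicExp.norm_natCast_prime]

/-- **The logarithmic matrix is invertible for deep generators.**  For `b_σ ∈ 𝓞_K` with
invertible embedding matrix `(τ(b_σ))` and an isometric `ι : ℚ̄_ℓ → E`, the matrix
`(L(ι τ(1 + ℓ^s b_σ)))_{σ,τ}` (`L` the logarithmic series) has non-zero determinant for all
large `s`: `L(1 + ℓ^s c) = ℓ^s (c + O(ℓ^{s}))`, and the determinant is continuous. [folklore] -/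
theorem exists_forall_det_ne_zero [DecidableEq (K →+* PadicAlgCl ℓ)] (ιE : PadicAlgCl ℓ →+* E)
    (hι : ∀ x, ‖ιE x‖ = ‖x‖)
    (bO : (K →+* PadicAlgCl ℓ) → 𝓞 K)
    (hdet : (Matrix.of fun σ τ : (K →+* PadicAlgCl ℓ) => τ ((bO σ : 𝓞 K) : K)).det ≠ 0) :
    ∃ s₁ : ℕ, ∀ s : ℕ, s₁ ≤ s →
      (Matrix.of fun σ τ : (K →+* PadicAlgCl ℓ) =>
        ∑' n : ℕ, -((1 - ιE (τ (1 + (ℓ : K) ^ s * ((bO σ : 𝓞 K) : K)))) ^ (n + 1)) /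
          (n + 1 : E)).det ≠ 0 := by
  classical
  have hp : ℓ.Prime := Fact.out
  have hq0 : (0 : ℝ) < (ℓ : ℝ)⁻¹ := inv_pos.mpr (by exact_mod_cast hp.pos)
  have hq1 : (ℓ : ℝ)⁻¹ < 1 := inv_lt_one_of_one_lt₀ (by exact_mod_cast hp.one_lt)
  have hq2 : (ℓ : ℝ)⁻¹ ≤ 1 / 2 := by
    rw [one_div]; exact inv_anti₀ two_pos (by exact_mod_cast hp.two_le)
  have hℓE : (ℓ : E) ≠ 0 := fun h => by
    have := PadicExp.norm_natCast_prime (ℓ := ℓ) (E := E)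
    rw [h, norm_zero] at this
    exact hq0.ne this
  -- the embedded basis `c σ τ = ι τ(b_σ)`, of norm `≤ 1`, with invertible matrix
  set c : (K →+* PadicAlgCl ℓ) → (K →+* PadicAlgCl ℓ) → E := fun σ τ => ιE (τ ((bO σ : 𝓞 K) : K))
    with hc
  have hcn : ∀ σ τ, ‖c σ τ‖ ≤ 1 := fun σ τ => by
    rw [hc, hι]; exact norm_embedding_coe_le_one τ (bO σ)
  have hdetE : (Matrix.of fun σ τ => c σ τ).det ≠ 0 := by
    have hmap : (Matrix.of fun σ τ => c σ τ) =
        ιE.mapMatrix (Matrix.of fun σ τ : (K →+* PadicAlgCl ℓ) => τ ((bO σ : 𝓞 K) : K)) := by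
      ext σ τ; rfl
    rw [hmap, ← RingHom.map_det]
    exact (map_ne_zero ιE).mpr hdet
  -- the entries: `y = ι τ(γ_σ) = 1 + ℓ^s c`
  have hy : ∀ (s : ℕ) (σ τ : K →+* PadicAlgCl ℓ),
      ιE (τ (1 + (ℓ : K) ^ s * ((bO σ : 𝓞 K) : K))) = 1 + (ℓ : E) ^ s * c σ τ := by
    intro s σ τ
    rw [map_add, map_one, map_mul, map_pow, map_natCast, map_add, map_one, map_mul, map_pow,
      map_natCast]
  have h1y : ∀ (s : ℕ) (σ τ : K →+* PadicAlgCl ℓ),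
      ‖1 - ιE (τ (1 + (ℓ : K) ^ s * ((bO σ : 𝓞 K) : K)))‖ ≤ ((ℓ : ℝ)⁻¹) ^ s := by
    intro s σ τ
    rw [hy, show (1 : E) - (1 + (ℓ : E) ^ s * c σ τ) = -((ℓ : E) ^ s * c σ τ) by ring, norm_neg,
      norm_mul, norm_ell_pow]
    exact mul_le_of_le_one_right (pow_nonneg hq0.le _) (hcn σ τ)
  -- the normalised matrix `N s = ℓ^{-s} M s` tends to `(c)`
  set N : ℕ → Matrix (K →+* PadicAlgCl ℓ) (K →+* PadicAlgCl ℓ) E := fun s =>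
    Matrix.of fun (σ τ : K →+* PadicAlgCl ℓ) => (∑' n : ℕ, -((1 - ιE (τ (1 + (ℓ : K) ^ s * ((bO σ : 𝓞 K) : K)))) ^
      (n + 1)) / (n + 1 : E)) / (ℓ : E) ^ s with hN
  have hNapply : ∀ (s : ℕ) (σ τ : K →+* PadicAlgCl ℓ), N s σ τ =
      (∑' n : ℕ, -((1 - ιE (τ (1 + (ℓ : K) ^ s * ((bO σ : 𝓞 K) : K)))) ^ (n + 1)) / (n + 1 : E)) /
        (ℓ : E) ^ s := fun _ _ _ => rfl
  have hbound : ∀ s : ℕ, 1 ≤ s → ∀ σ τ : K →+* PadicAlgCl ℓ,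
      ‖N s σ τ - c σ τ‖ ≤ 2 * ((ℓ : ℝ)⁻¹) ^ s := by
    intro s hs σ τ
    have hys : ((ℓ : ℝ)⁻¹) ^ s ≤ 1 / 2 :=
      (pow_le_pow_left₀ hq0.le hq2 s).trans (by
        rw [show ((1 : ℝ) / 2) ^ s = (1 / 2) * (1 / 2) ^ (s - 1) by
          rw [← pow_succ', Nat.sub_add_cancel hs]]
        exact mul_le_of_le_one_right (by norm_num) (pow_le_one₀ (by norm_num) (by norm_num)))
    have h2 := LogE.norm_logSeries_add_le (ℓ := ℓ) ((h1y s σ τ).trans hys)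
    have hpow0 : (ℓ : E) ^ s ≠ 0 := pow_ne_zero _ hℓE
    have e1 : N s σ τ - c σ τ = ((∑' n : ℕ, -((1 - ιE (τ (1 + (ℓ : K) ^ s *
        ((bO σ : 𝓞 K) : K)))) ^ (n + 1)) / (n + 1 : E)) +
        (1 - ιE (τ (1 + (ℓ : K) ^ s * ((bO σ : 𝓞 K) : K))))) / (ℓ : E) ^ s := by
      rw [hNapply, hy]
      field_simp
      ring
    rw [e1, norm_div, norm_ell_pow, div_le_iff₀ (pow_pos hq0 _)]
    refine h2.trans ?_
    have h3 := h1y s σ τ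
    calc 2 * ‖1 - ιE (τ (1 + (ℓ : K) ^ s * ((bO σ : 𝓞 K) : K)))‖ ^ 2
        ≤ 2 * (((ℓ : ℝ)⁻¹) ^ s) ^ 2 := by gcongr
      _ = 2 * ((ℓ : ℝ)⁻¹) ^ s * ((ℓ : ℝ)⁻¹) ^ s := by ring
  have hNt : Tendsto N atTop (𝓝 (Matrix.of fun σ τ => c σ τ)) := by
    refine tendsto_pi_nhds.mpr fun σ => ?_
    refine tendsto_pi_nhds.mpr fun τ => ?_
    change Tendsto (fun s => N s σ τ) atTop (𝓝 (c σ τ))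
    rw [tendsto_iff_norm_sub_tendsto_zero]
    have hlim : Tendsto (fun s : ℕ => 2 * ((ℓ : ℝ)⁻¹) ^ s) atTop (𝓝 0) := by
      have := (tendsto_pow_atTop_nhds_zero_of_lt_one hq0.le hq1).const_mul 2
      rwa [mul_zero] at this
    refine squeeze_zero_norm' ?_ hlim
    rw [eventually_atTop]
    refine ⟨1, fun s hs => ?_⟩
    rw [Real.norm_eq_abs, abs_of_nonneg (norm_nonneg _)]
    exact hbound s hs σ τ
  -- continuity of the determinant
  have hdetlim : Tendsto (fun s => (N s).det) atTop (𝓝 (Matrix.of fun σ τ => c σ τ).det) :=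
    ((continuous_id.matrix_det).tendsto _).comp hNt
  have hev : ∀ᶠ s in atTop, (N s).det ≠ 0 := hdetlim.eventually_ne hdetE
  obtain ⟨s₁, hs₁⟩ := eventually_atTop.mp hev
  refine ⟨s₁, fun s hs => ?_⟩
  -- `M s = ℓ^s • N s`
  have hM : (Matrix.of fun σ τ : (K →+* PadicAlgCl ℓ) =>
      ∑' n : ℕ, -((1 - ιE (τ (1 + (ℓ : K) ^ s * ((bO σ : 𝓞 K) : K)))) ^ (n + 1)) / (n + 1 : E)) =
      ((ℓ : E) ^ s) • N s := by
    ext σ τ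
    rw [Matrix.smul_apply, hNapply, Matrix.of_apply, smul_eq_mul,
      mul_div_cancel₀ _ (pow_ne_zero _ hℓE)]
  rw [hM, Matrix.det_smul]
  exact mul_ne_zero (pow_ne_zero _ (pow_ne_zero _ hℓE)) (hs₁ s hs)

end Expansion

end Literature.NumberTheory.GaloisRepresentations

end PartA2

section PartA3
open scoped NumberField
open NumberField IsDedekindDomain IsDedekindDomain.HeightOneSpectrum Filter Topology Finset NormedSpace
open Literature.NumberTheory.Transcendental

namespace Literature.NumberTheory.GaloisRepresentations

namespace Expansion

variable {K : Type} [Field K] [NumberField K] {ℓ : ℕ} [Fact ℓ.Prime]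

/-! ### Embedding estimates from congruences -/

/-- `x ≡ 0 [ℓ^j]` gives `‖τ x‖ ≤ ℓ^{-j}` under every embedding `τ : K → ℚ̄_ℓ`. [folklore] -/
theorem norm_embedding_le_of_cong {x : K} {j : ℕ}
    (hx : ∀ v : HeightOneSpectrum (𝓞 K), (ℓ : 𝓞 K) ∈ v.asIdeal →
      v.valuation K x ≤ v.valuation K ((ℓ : K) ^ j)) (τ : K →+* PadicAlgCl ℓ) :
    ‖τ x‖ ≤ ((ℓ : ℝ)⁻¹) ^ j := by
  have hℓ : ℓ.Prime := Fact.out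
  have hℓ0 : (ℓ : K) ≠ 0 := by exact_mod_cast hℓ.ne_zero
  set z : K := x / (ℓ : K) ^ j with hzdef
  have hxz : x = (ℓ : K) ^ j * z := by rw [hzdef]; field_simp
  have hz : ∀ v : HeightOneSpectrum (𝓞 K), (ℓ : 𝓞 K) ∈ v.asIdeal → v.valuation K z ≤ 1 := by
    intro v hv
    have hpow0 : v.valuation K ((ℓ : K) ^ j) ≠ 0 := (Valuation.ne_zero_iff _).mpr (pow_ne_zero _ hℓ0)
    rw [hzdef, map_div₀, div_le_one₀ (zero_lt_iff.mpr hpow0)]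
    exact hx v hv
  have h1 := FramedGaloisRep.norm_embedding_le_one_of_valuation_le_one hz τ
  rw [hxz, map_mul, map_pow, map_natCast, norm_mul, norm_pow, PadicAlgCl.norm_natCast_self]
  exact mul_le_of_le_one_right (pow_nonneg (inv_nonneg.mpr (Nat.cast_nonneg _)) _) h1

/-- `k ≡ P [ℓ^j]` gives `‖τ k - τ P‖ ≤ ℓ^{-j}`. [folklore] -/
theorem norm_embedding_sub_le_of_cong {k P : K} {j : ℕ}
    (h : ∀ v : HeightOneSpectrum (𝓞 K), (ℓ : 𝓞 K) ∈ v.asIdeal →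
      v.valuation K (k - P) ≤ v.valuation K ((ℓ : K) ^ j)) (τ : K →+* PadicAlgCl ℓ) :
    ‖τ k - τ P‖ ≤ ((ℓ : ℝ)⁻¹) ^ j := by
  rw [← map_sub]; exact norm_embedding_le_of_cong h τ

omit [Fact ℓ.Prime] in
/-- The congruence `u ≡ 1 [ℓ^j]` in valuation form at a place above `ℓ`:
`|u - 1|_v ≤ |ϖ_v|^j`. [folklore] -/
theorem valued_sub_one_le_of_cong {u : K} {j : ℕ}
    (h : ∀ v : HeightOneSpectrum (𝓞 K), (ℓ : 𝓞 K) ∈ v.asIdeal →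
      v.valuation K (u - 1) ≤ v.valuation K ((ℓ : K) ^ j))
    {v : HeightOneSpectrum (𝓞 K)} (hv : (ℓ : 𝓞 K) ∈ v.asIdeal) :
    Valued.v (algebraMap K (v.adicCompletion K) u - 1) ≤ WithZero.exp (-(j : ℤ)) := by
  rw [← map_one (algebraMap K (v.adicCompletion K)), ← map_sub, valued_algebraMap_adicCompletion]
  refine (h v hv).trans ?_
  rw [Valuation.map_pow, show (ℓ : K) = algebraMap (𝓞 K) K (ℓ : 𝓞 K) by simp,
    valuation_of_algebraMap]
  have h1 : v.intValuation (ℓ : 𝓞 K) ≤ WithZero.exp (-(1 : ℤ)) := by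
    have := (v.intValuation_le_pow_iff_mem (ℓ : 𝓞 K) 1).mpr (by rwa [pow_one])
    simpa using this
  calc v.intValuation (ℓ : 𝓞 K) ^ j ≤ (WithZero.exp (-(1 : ℤ))) ^ j := pow_le_pow_left' h1 j
    _ = WithZero.exp (-(j : ℤ)) := by
        rw [← WithZero.exp_nsmul]; congr 1; simp

variable {E : Type} [NontriviallyNormedField E] [NormedAlgebra ℚ_[ℓ] E] [IsUltrametricDist E]
  [CompleteSpace E]

/-- `exp` of a finite sum of small elements is the product of the exponentials. [folklore] -/
theorem exp_sum {ι : Type*} (s : Finset ι) (z : ι → E) (hz : ∀ i ∈ s, ‖z i‖ < (ℓ : ℝ)⁻¹) :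
    exp (∑ i ∈ s, z i) = ∏ i ∈ s, exp (z i) := by
  classical
  have hp : ℓ.Prime := Fact.out
  have hq0 : (0 : ℝ) < (ℓ : ℝ)⁻¹ := inv_pos.mpr (by exact_mod_cast hp.pos)
  induction s using Finset.induction_on with
  | empty => simp
  | insert a s ha ih =>
    have hz' : ∀ i ∈ s, ‖z i‖ < (ℓ : ℝ)⁻¹ := fun i hi => hz i (Finset.mem_insert_of_mem hi)
    rw [Finset.sum_insert ha, Finset.prod_insert ha,
      PadicExp.exp_add (hz a (Finset.mem_insert_self a s))
        (SixExpPadic.norm_sum_lt_of_forall_lt s z hq0 hz'), ih hz']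

omit [NormedAlgebra ℚ_[ℓ] E] [IsUltrametricDist E] [CompleteSpace E] in
/-- **Continuity of the avatar in the congruence depth**: for `δ > 0` there is `j₀` with
`‖ι(∏_{v∈L} Ψ(⟨u⟩_v)) - 1‖ < δ` for every `u ∈ Kˣ` with `u ≡ 1 [ℓ^{j₀}]` (`L` = places above
`ℓ`). [folklore] -/
theorem exists_forall_norm_prod_sub_one_lt (Ψ : ideleGroup K →ₜ* (PadicAlgCl ℓ)ˣ)
    (ιE : PadicAlgCl ℓ →+* E) (hι : ∀ x, ‖ιE x‖ = ‖x‖)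
    (L : Finset (HeightOneSpectrum (𝓞 K))) (hL : ∀ v, v ∈ L → (ℓ : 𝓞 K) ∈ v.asIdeal)
    {δ : ℝ} (hδ : 0 < δ) :
    ∃ j₀ : ℕ, 1 ≤ j₀ ∧ ∀ u : Kˣ, (∀ v : HeightOneSpectrum (𝓞 K), (ℓ : 𝓞 K) ∈ v.asIdeal →
      v.valuation K ((u : K) - 1) ≤ v.valuation K ((ℓ : K) ^ j₀)) →
      ‖ιE (∏ v ∈ L, ((Ψ (localUnits v (globalToLocalUnits v u)) : (PadicAlgCl ℓ)ˣ) :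
        PadicAlgCl ℓ)) - 1‖ < δ := by
  classical
  -- the one-units subgroup of radius `min δ 1`
  set r : ℝ := min δ 1 with hr
  have hr0 : 0 < r := lt_min hδ one_pos
  have hr1 : r ≤ 1 := min_le_right _ _
  obtain ⟨U, hU, -⟩ := exists_subgroup_units_norm_sub_one_lt (L := PadicAlgCl ℓ) hr0 hr1
  choose e he using fun v : HeightOneSpectrum (𝓞 K) =>
    IdelicCharacter.exists_forall_valued_le_norm_sub_one_lt Ψ v hr0
  refine ⟨L.sup e + 1, by omega, fun u hu => ?_⟩
  -- each local factor lies in `U`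
  have hfac : ∀ v ∈ L, Ψ (localUnits v (globalToLocalUnits v u)) ∈ U := by
    intro v hv
    have hcong := valued_sub_one_le_of_cong hu (hL v hv)
    have h1 : Valued.v ((globalToLocalUnits v u : (v.adicCompletion K)ˣ) : v.adicCompletion K)
        = 1 := by
      rw [val_globalToLocalUnits]
      have hlt : WithZero.exp (-((L.sup e + 1 : ℕ) : ℤ)) < 1 := by
        rw [← WithZero.exp_zero, WithZero.exp_lt_exp]; omega
      have h2 := Valuation.map_one_add_of_lt Valued.v (hcong.trans_lt hlt)
      rwa [add_sub_cancel] at h2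
    obtain ⟨w, hw⟩ := IdelicCharacter.exists_unitsMap_eq_of_valued_eq_one _ h1
    have hwcoe : ((w : v.adicCompletionIntegers K) : v.adicCompletion K) =
        algebraMap K (v.adicCompletion K) (u : K) := by
      have := congrArg (fun x : (v.adicCompletion K)ˣ => (x : v.adicCompletion K)) hw
      simpa using this
    rw [← hw, hU]
    refine he v w ?_
    rw [hwcoe]
    refine hcong.trans (WithZero.exp_le_exp.mpr ?_)
    have := Finset.le_sup (f := e) hv
    omega
  have hprod : (∏ v ∈ L, Ψ (localUnits v (globalToLocalUnits v u))) ∈ U :=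
    Subgroup.prod_mem U fun v hv => hfac v hv
  rw [hU, Units.coe_prod] at hprod
  rw [← map_one ιE, ← map_sub, hι]
  exact hprod.trans_le (min_le_left _ _)

end Expansion

end Literature.NumberTheory.GaloisRepresentations

end PartA3

section PartA3b
open scoped NumberField Matrix
open NumberField IsDedekindDomain IsDedekindDomain.HeightOneSpectrum Filter Topology Finset NormedSpace
open Literature.NumberTheory.Transcendental

namespace Literature.NumberTheory.GaloisRepresentations

namespace Expansion

variable {K : Type} [Field K] [NumberField K] {ℓ : ℕ} [Fact ℓ.Prime]
variable {E : Type} [NontriviallyNormedField E] [NormedAlgebra ℚ_[ℓ] E] [IsUltrametricDist E]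
  [CompleteSpace E]

omit [NormedAlgebra ℚ_[ℓ] E] [IsUltrametricDist E] [CompleteSpace E] in
/-- The `τ`-th coordinate of `v ᵥ* M`. [folklore] -/
theorem vecMul_apply' (v : (K →+* PadicAlgCl ℓ) → E)
    (M : Matrix (K →+* PadicAlgCl ℓ) (K →+* PadicAlgCl ℓ) E) (τ : K →+* PadicAlgCl ℓ) :
    (v ᵥ* M) τ = ∑ σ, v σ * M σ τ := rfl

/-- **The key limit argument.**  Let `γ_σ ∈ Kˣ` be generators whose images under every
`ι ∘ τ` are principal units, `M = (L(ι τ γ_σ))` their logarithmic matrix with a right inverse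
`Minv` for `ᵥ*`, `Φ : Kˣ → E` multiplicative on monomials in the `γ_σ` with `Φ(γ_σ) = exp c_σ`,
`‖c_σ‖ < r ≤ ℓ⁻¹`.  If a sequence of monomials `γ^{A(n)}` converges to `k` logarithmically under
every `ι ∘ τ` and `Φ(γ^{A(n)}) → Φ(k)`, then `Φ(k) = exp(∑_τ λ_τ L(ι τ k))` with `λ = Minv c`,
and the exponent has norm `< r`. [folklore] -/
theorem key (ιE : PadicAlgCl ℓ →+* E) (γu : (K →+* PadicAlgCl ℓ) → Kˣ)
    (hγ1 : ∀ σ τ : K →+* PadicAlgCl ℓ, ‖1 - ιE (τ (γu σ : K))‖ < 1)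
    (M Minv : Matrix (K →+* PadicAlgCl ℓ) (K →+* PadicAlgCl ℓ) E)
    (hM : ∀ σ τ : K →+* PadicAlgCl ℓ,
      M σ τ = ∑' m : ℕ, -((1 - ιE (τ (γu σ : K))) ^ (m + 1)) / (m + 1 : E))
    (hMinv : ∀ w : (K →+* PadicAlgCl ℓ) → E, (w ᵥ* M) ᵥ* Minv = w)
    {r : ℝ} (hr0 : 0 < r) (hr : r ≤ (ℓ : ℝ)⁻¹) (c : (K →+* PadicAlgCl ℓ) → E)
    (hc : ∀ σ, ‖c σ‖ < r)
    (Φ : Kˣ → E) (hΦγ : ∀ σ, Φ (γu σ) = exp (c σ))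
    (hΦmul : ∀ A : (K →+* PadicAlgCl ℓ) → ℕ, Φ (∏ σ, γu σ ^ A σ) = ∏ σ, Φ (γu σ) ^ A σ)
    (k : Kˣ) (A : ℕ → (K →+* PadicAlgCl ℓ) → ℕ)
    (hAL : ∀ τ : K →+* PadicAlgCl ℓ, Tendsto (fun n => ∑' m : ℕ,
        -((1 - ιE (τ ((∏ σ, γu σ ^ A n σ : Kˣ) : K))) ^ (m + 1)) / (m + 1 : E)) atTop
        (𝓝 (∑' m : ℕ, -((1 - ιE (τ (k : K))) ^ (m + 1)) / (m + 1 : E))))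
    (hAΦ : Tendsto (fun n => Φ (∏ σ, γu σ ^ A n σ)) atTop (𝓝 (Φ k))) :
    ‖∑ τ, (Minv *ᵥ c) τ * ∑' m : ℕ, -((1 - ιE (τ (k : K))) ^ (m + 1)) / (m + 1 : E)‖ < r ∧
      Φ k = exp (∑ τ, (Minv *ᵥ c) τ *
        ∑' m : ℕ, -((1 - ιE (τ (k : K))) ^ (m + 1)) / (m + 1 : E)) := by
  classical
  have hq : ∀ σ, ‖c σ‖ < (ℓ : ℝ)⁻¹ := fun σ => (hc σ).trans_le hr
  -- notation
  set Lk : (K →+* PadicAlgCl ℓ) → E := fun τ =>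
    ∑' m : ℕ, -((1 - ιE (τ (k : K))) ^ (m + 1)) / (m + 1 : E) with hLk
  set a : ℕ → (K →+* PadicAlgCl ℓ) → E := fun n σ => (A n σ : E) with ha
  have han : ∀ n σ, ‖a n σ‖ ≤ 1 := fun n σ => PadicExp.norm_natCast_le_one (ℓ := ℓ) _
  -- step 1: logarithms of monomials
  have hstep1 : ∀ (n : ℕ) (τ : K →+* PadicAlgCl ℓ),
      (∑' m : ℕ, -((1 - ιE (τ ((∏ σ, γu σ ^ A n σ : Kˣ) : K))) ^ (m + 1)) / (m + 1 : E)) =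
        (a n ᵥ* M) τ := by
    intro n τ
    have hcoe : ιE (τ ((∏ σ, γu σ ^ A n σ : Kˣ) : K)) = ∏ σ, (ιE (τ (γu σ : K))) ^ A n σ := by
      rw [Units.coe_prod, map_prod, map_prod]
      refine Finset.prod_congr rfl fun σ _ => ?_
      rw [Units.val_pow_eq_pow_val, map_pow, map_pow]
    rw [hcoe, LogE.logSeries_prod_pow (ℓ := ℓ) _ _ _ (fun σ _ => hγ1 σ τ), vecMul_apply']
    refine Finset.sum_congr rfl fun σ _ => ?_
    rw [hM, ha]
  -- step 2: `a n ᵥ* M → Lk`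
  have hstep2 : Tendsto (fun n => a n ᵥ* M) atTop (𝓝 Lk) := by
    refine tendsto_pi_nhds.mpr fun τ => ?_
    refine (hAL τ).congr fun n => ?_
    exact hstep1 n τ
  -- step 3: `a n → a∞ = Lk ᵥ* Minv`
  set ainf : (K →+* PadicAlgCl ℓ) → E := Lk ᵥ* Minv with hainf
  have hstep3 : Tendsto a atTop (𝓝 ainf) := by
    have e : ∀ n, a n = (a n ᵥ* M) ᵥ* Minv := fun n => (hMinv (a n)).symm
    refine tendsto_pi_nhds.mpr fun σ => ?_
    have h1 : Tendsto (fun n => ((a n ᵥ* M) ᵥ* Minv) σ) atTop (𝓝 ((Lk ᵥ* Minv) σ)) := by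
      simp only [vecMul_apply']
      refine tendsto_finsetSum _ fun τ _ => ?_
      exact ((tendsto_pi_nhds.mp hstep2) τ).mul_const _
    refine h1.congr fun n => ?_
    exact congrFun (e n).symm σ
  -- step 4: `‖a∞ σ‖ ≤ 1`
  have hainf1 : ∀ σ, ‖ainf σ‖ ≤ 1 := fun σ =>
    le_of_tendsto' ((continuous_norm.tendsto _).comp ((tendsto_pi_nhds.mp hstep3) σ))
      fun n => han n σ
  -- step 5: `Φ(γ^{A n}) = exp (∑ a n σ c σ)`
  have hstep5 : ∀ n, Φ (∏ σ, γu σ ^ A n σ) = exp (∑ σ, a n σ * c σ) := by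
    intro n
    rw [hΦmul, exp_sum (ℓ := ℓ) _ _ (fun σ _ => ?_)]
    · refine Finset.prod_congr rfl fun σ _ => ?_
      rw [hΦγ, ha]
      exact (PadicExp.exp_natCast_mul (hq σ) (A n σ)).symm
    · rw [norm_mul]
      exact (mul_le_of_le_one_left (norm_nonneg _) (han n σ)).trans_lt (hq σ)
  -- step 6: the exponents converge to `z∞ = ∑ a∞ σ c σ`, of norm `< r`
  set zinf : E := ∑ σ, ainf σ * c σ with hzinf
  have hstep6 : Tendsto (fun n => ∑ σ, a n σ * c σ) atTop (𝓝 zinf) := by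
    refine tendsto_finsetSum _ fun σ _ => ?_
    exact ((tendsto_pi_nhds.mp hstep3) σ).mul_const _
  have hzr : ‖zinf‖ < r := by
    refine SixExpPadic.norm_sum_lt_of_forall_lt _ _ hr0 fun σ _ => ?_
    rw [norm_mul]
    exact (mul_le_of_le_one_left (norm_nonneg _) (hainf1 σ)).trans_lt (hc σ)
  -- step 7: continuity of `exp` at `z∞`
  have hcont : ContinuousAt exp zinf :=
    (PadicExp.continuousOn_exp (ℓ := ℓ)).continuousAt
      ((isOpen_lt continuous_norm continuous_const).mem_nhds (hzr.trans_le hr))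
  have hstep7 : Tendsto (fun n => exp (∑ σ, a n σ * c σ)) atTop (𝓝 (exp zinf)) :=
    hcont.tendsto.comp hstep6
  have hΦk : Φ k = exp zinf := tendsto_nhds_unique (hAΦ.congr hstep5) hstep7
  -- step 8: `z∞ = ∑ λ_τ L_τ(k)`
  have hz : zinf = ∑ τ, (Minv *ᵥ c) τ * Lk τ := by
    have h1 : zinf = (Lk ᵥ* Minv) ⬝ᵥ c := rfl
    rw [h1, ← Matrix.dotProduct_mulVec]
    simp only [dotProduct]
    refine Finset.sum_congr rfl fun τ _ => ?_
    rw [mul_comm]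
  refine ⟨?_, ?_⟩
  · rw [← hz]; exact hzr
  · rw [← hz]; exact hΦk

end Expansion

end Literature.NumberTheory.GaloisRepresentations

end PartA3b

section PartA3c
open scoped NumberField Matrix
open NumberField IsDedekindDomain IsDedekindDomain.HeightOneSpectrum Filter Topology Finset NormedSpace
open Literature.NumberTheory.Transcendental

namespace Literature.NumberTheory.GaloisRepresentations

namespace Expansion

variable {K : Type} [Field K] [NumberField K] {ℓ : ℕ} [Fact ℓ.Prime]
variable {E : Type} [NontriviallyNormedField E] [NormedAlgebra ℚ_[ℓ] E] [IsUltrametricDist E]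
  [CompleteSpace E]

/-- **The `ℓ`-adic analytic expansion of an idelic character and of the embeddings at the
places above `ℓ`.**  Let `Ψ : 𝕀_K → ℚ̄_ℓˣ` be a continuous character, `ι : ℚ̄_ℓ → E` an isometric
embedding into a complete ultrametric normed `ℚ_ℓ`-algebra field (e.g. `ℂ_ℓ`), `L` a set of
places above `ℓ`, `ε > 0`.  Then there are a depth `s ≥ 2` and coefficients
`λ_τ, μ_{τ₀,τ} ∈ E` (`τ, τ₀` over the embeddings `K → ℚ̄_ℓ`) such that for every `k ∈ Kˣ` with
`k ≡ 1 [ℓ^s]` (i.e. `|k - 1|_v ≤ |ℓ^s|_v` at all `v ∣ ℓ`), writing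
`L_τ(k) = -∑_{m≥1} (1 - ι τ k)^m/m` for the logarithmic series:
`ι(∏_{v∈L} Ψ(⟨k⟩_v)) = exp(∑_τ λ_τ L_τ(k))` and `ι(τ₀ k) = exp(∑_τ μ_{τ₀,τ} L_τ(k))`, both exponents
having norm `< ε`.  (Successive approximation of `k` by monomials in `γ_σ = 1 + ℓ^s b_σ`,
`(b_σ)` an integral basis; invertibility of the logarithmic matrix `(L_τ(γ_σ))`; continuity.)
[cite: SerreAbelianLadic1968, Ch. III §1.1 (local algebraicity, the Lie algebra description)]
[cite: BockleHui2025, §2.3] -/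
theorem exists_expansion (Ψ : ideleGroup K →ₜ* (PadicAlgCl ℓ)ˣ)
    (ιE : PadicAlgCl ℓ →+* E) (hι : ∀ x, ‖ιE x‖ = ‖x‖)
    (L : Finset (HeightOneSpectrum (𝓞 K))) (hL : ∀ v, v ∈ L → (ℓ : 𝓞 K) ∈ v.asIdeal)
    {ε : ℝ} (hε : 0 < ε) :
    ∃ s : ℕ, 2 ≤ s ∧ ∃ (lam : (K →+* PadicAlgCl ℓ) → E)
      (mu : (K →+* PadicAlgCl ℓ) → (K →+* PadicAlgCl ℓ) → E),
      ∀ k : Kˣ, (∀ v : HeightOneSpectrum (𝓞 K), (ℓ : 𝓞 K) ∈ v.asIdeal →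
          v.valuation K ((k : K) - 1) ≤ v.valuation K ((ℓ : K) ^ s)) →
        (∀ τ : K →+* PadicAlgCl ℓ, ‖1 - ιE (τ (k : K))‖ ≤ ((ℓ : ℝ)⁻¹) ^ s) ∧
        ‖∑ τ, lam τ * ∑' m : ℕ, -((1 - ιE (τ (k : K))) ^ (m + 1)) / (m + 1 : E)‖ < ε ∧
        ιE (∏ v ∈ L, ((Ψ (localUnits v (globalToLocalUnits v k)) : (PadicAlgCl ℓ)ˣ) :
          PadicAlgCl ℓ)) =
          exp (∑ τ, lam τ * ∑' m : ℕ, -((1 - ιE (τ (k : K))) ^ (m + 1)) / (m + 1 : E)) ∧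
        ∀ τ₀ : K →+* PadicAlgCl ℓ,
          ‖∑ τ, mu τ₀ τ * ∑' m : ℕ, -((1 - ιE (τ (k : K))) ^ (m + 1)) / (m + 1 : E)‖ < ε ∧
          ιE (τ₀ (k : K)) =
            exp (∑ τ, mu τ₀ τ * ∑' m : ℕ, -((1 - ιE (τ (k : K))) ^ (m + 1)) / (m + 1 : E)) := by
  classical
  have hp : ℓ.Prime := Fact.out
  set q : ℝ := (ℓ : ℝ)⁻¹ with hqdef
  have hq0 : 0 < q := inv_pos.mpr (by exact_mod_cast hp.pos)
  have hq1 : q < 1 := inv_lt_one_of_one_lt₀ (by exact_mod_cast hp.one_lt)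
  have hq2 : q ≤ 1 / 2 := by
    rw [hqdef, one_div]; exact inv_anti₀ two_pos (by exact_mod_cast hp.two_le)
  -- the radius `r`
  set r : ℝ := min ε q with hrdef
  have hr0 : 0 < r := lt_min hε hq0
  have hrq : r ≤ (ℓ : ℝ)⁻¹ := min_le_right _ _
  have hrε : r ≤ ε := min_le_left _ _
  -- the integral basis and the invertibility depth
  obtain ⟨bO, hdet⟩ := exists_basis_det_ne_zero (K := K) (ℓ := ℓ)
  obtain ⟨s₁, hs₁⟩ := exists_forall_det_ne_zero ιE hι (fun σ => bO σ) hdet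
  -- local surjectivity of `exp`, continuity of `Ψ`
  obtain ⟨δ, hδ, hsurj⟩ := PadicExp.exists_forall_exists_exp_eq (ℓ := ℓ) (E := E) hr0
  obtain ⟨j₀, -, hj₀⟩ := exists_forall_norm_prod_sub_one_lt Ψ ιE hι L hL hδ
  obtain ⟨s₂, hs₂⟩ := exists_pow_lt_of_lt_one hδ hq1
  -- the depth `s`
  set s : ℕ := max (max 2 s₁) (max j₀ s₂) with hsdef
  have hs2 : 2 ≤ s := by omega
  have hss₁ : s₁ ≤ s := by omega
  have hsj₀ : j₀ ≤ s := by omega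
  have hqs : q ^ s < δ := (pow_le_pow_of_le_one hq0.le hq1.le (by omega : s₂ ≤ s)).trans_lt hs₂
  have hqs1 : q ^ s < 1 := pow_lt_one₀ hq0.le hq1 (by omega)
  have hqs4 : q ^ s ≤ 1 / 4 := by
    calc q ^ s ≤ q ^ 2 := pow_le_pow_of_le_one hq0.le hq1.le hs2
      _ ≤ (1 / 2) ^ 2 := pow_le_pow_left₀ hq0.le hq2 2
      _ = 1 / 4 := by norm_num
  -- the generators `γ_σ = 1 + ℓ^s b_σ`
  set γ : (K →+* PadicAlgCl ℓ) → K := fun σ => 1 + (ℓ : K) ^ s * ((bO σ : 𝓞 K) : K) with hγdef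
  have hγcong : ∀ σ, ∀ v : HeightOneSpectrum (𝓞 K), (ℓ : 𝓞 K) ∈ v.asIdeal →
      v.valuation K (γ σ - 1) ≤ v.valuation K ((ℓ : K) ^ s) :=
    fun σ => Cong.gen_sub_one (K := K) (ℓ := ℓ) (fun σ => bO σ) s σ
  have hγnorm : ∀ σ τ : K →+* PadicAlgCl ℓ, ‖1 - ιE (τ (γ σ))‖ ≤ q ^ s := by
    intro σ τ
    rw [← map_one ιE, ← map_sub, hι, ← map_one τ, ← map_sub, ← neg_sub, map_neg, norm_neg]
    exact norm_embedding_le_of_cong (hγcong σ) τ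
  have hγ0 : ∀ σ, γ σ ≠ 0 := by
    intro σ h0
    obtain ⟨τ⟩ := (inferInstance : Nonempty (K →+* PadicAlgCl ℓ))
    have h1 := hγnorm σ τ
    rw [h0, map_zero, map_zero, sub_zero, norm_one] at h1
    exact absurd (h1.trans_lt hqs1) (lt_irrefl 1)
  set γu : (K →+* PadicAlgCl ℓ) → Kˣ := fun σ => Units.mk0 (γ σ) (hγ0 σ) with hγudef
  have hγuval : ∀ σ, ((γu σ : Kˣ) : K) = γ σ := fun σ => rfl
  have hγ1 : ∀ σ τ : K →+* PadicAlgCl ℓ, ‖1 - ιE (τ (γu σ : K))‖ < 1 := fun σ τ =>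
    (hγnorm σ τ).trans_lt hqs1
  -- the logarithmic matrix and its inverse
  set M : Matrix (K →+* PadicAlgCl ℓ) (K →+* PadicAlgCl ℓ) E := Matrix.of fun σ τ =>
    ∑' n : ℕ, -((1 - ιE (τ (1 + (ℓ : K) ^ s * ((bO σ : 𝓞 K) : K)))) ^ (n + 1)) / (n + 1 : E)
    with hMdef
  have hMdet : M.det ≠ 0 := hs₁ s hss₁
  have hM : ∀ σ τ : K →+* PadicAlgCl ℓ,
      M σ τ = ∑' m : ℕ, -((1 - ιE (τ (γu σ : K))) ^ (m + 1)) / (m + 1 : E) := fun σ τ => rfl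
  have hMinv : ∀ w : (K →+* PadicAlgCl ℓ) → E, (w ᵥ* M) ᵥ* M⁻¹ = w := by
    intro w
    rw [Matrix.vecMul_vecMul, Matrix.mul_nonsing_inv M (isUnit_iff_ne_zero.mpr hMdet),
      Matrix.vecMul_one]
  -- the avatar product as a monoid homomorphism `Φ_F : Kˣ → E`
  set φL : Kˣ →* (PadicAlgCl ℓ)ˣ :=
    ∏ v ∈ L, Ψ.toMonoidHom.comp ((localUnits v).comp (globalToLocalUnits (K := K) v)) with hφL
  have hφL : ∀ u : Kˣ, φL u = ∏ v ∈ L, Ψ (localUnits v (globalToLocalUnits v u)) := by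
    intro u
    rw [hφL, MonoidHom.finsetProd_apply]
    rfl
  set ΦF : Kˣ →* E := (ιE.toMonoidHom.comp (Units.coeHom (PadicAlgCl ℓ))).comp φL with hΦFdef
  have hΦF : ∀ u : Kˣ, ΦF u = ιE (∏ v ∈ L, ((Ψ (localUnits v (globalToLocalUnits v u)) :
      (PadicAlgCl ℓ)ˣ) : PadicAlgCl ℓ)) := by
    intro u
    rw [hΦFdef, MonoidHom.comp_apply, hφL, MonoidHom.comp_apply, Units.coeHom_apply,
      Units.coe_prod]
    rfl
  -- `Φ_F(γ_σ) = exp c_σ`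
  have hΦFγ : ∀ σ, ‖ΦF (γu σ) - 1‖ < δ := by
    intro σ
    rw [hΦF]
    exact hj₀ (γu σ) (Cong.mono (hγcong σ) hsj₀)
  choose cF hcF hexpF using fun σ => hsurj _ (hΦFγ σ)
  -- `ι τ₀(γ_σ) = exp c'_{τ₀,σ}`
  have hτγ : ∀ τ₀ σ : K →+* PadicAlgCl ℓ, ‖ιE (τ₀ (γu σ : K)) - 1‖ < δ := by
    intro τ₀ σ
    rw [norm_sub_rev]
    exact (hγnorm σ τ₀).trans_lt hqs
  choose cτ hcτ hexpτ using fun τ₀ σ => hsurj _ (hτγ τ₀ σ)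
  refine ⟨s, hs2, M⁻¹ *ᵥ cF, fun τ₀ => M⁻¹ *ᵥ cτ τ₀, fun k hk => ?_⟩
  -- ### a principal unit `k ≡ 1 [ℓ^s]`
  have hk1 : ∀ τ : K →+* PadicAlgCl ℓ, ‖1 - ιE (τ (k : K))‖ ≤ q ^ s := by
    intro τ
    rw [← map_one ιE, ← map_sub, hι, ← map_one τ, ← map_sub, ← neg_sub, map_neg, norm_neg]
    exact norm_embedding_le_of_cong hk τ
  have hkunit := Cong.zero_inv_of_sub_one (show 1 ≤ s by omega) hk
  -- the approximating monomials
  set A : ℕ → (K →+* PadicAlgCl ℓ) → ℕ := fun n =>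
    Classical.choose (Cong.exists_monomial bO hs2 n hk) with hAdef
  have hA : ∀ n, ∀ v : HeightOneSpectrum (𝓞 K), (ℓ : 𝓞 K) ∈ v.asIdeal →
      v.valuation K ((k : K) - ((∏ σ, γu σ ^ A n σ : Kˣ) : K)) ≤
        v.valuation K ((ℓ : K) ^ (s + n)) := by
    intro n
    have h1 := Classical.choose_spec (Cong.exists_monomial bO hs2 n hk)
    have hcoe : ((∏ σ, γu σ ^ A n σ : Kˣ) : K) = ∏ σ, (1 + (ℓ : K) ^ s * ((bO σ : 𝓞 K) : K)) ^
        (Classical.choose (Cong.exists_monomial bO hs2 n hk)) σ := by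
      rw [Units.coe_prod]
      refine Finset.prod_congr rfl fun σ _ => ?_
      rw [Units.val_pow_eq_pow_val, hγuval]
    rw [hcoe]
    exact h1
  -- the quotients `P_n / k ≡ 1 [ℓ^{s+n}]`
  have hquot : ∀ n, ∀ v : HeightOneSpectrum (𝓞 K), (ℓ : 𝓞 K) ∈ v.asIdeal →
      v.valuation K ((((∏ σ, γu σ ^ A n σ) * k⁻¹ : Kˣ) : K) - 1) ≤
        v.valuation K ((ℓ : K) ^ (s + n)) := by
    intro n
    have h1 := Cong.mul (Cong.neg (hA n)) hkunit
    rw [add_zero] at h1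
    have e : (((∏ σ, γu σ ^ A n σ) * k⁻¹ : Kˣ) : K) - 1 =
        -((k : K) - ((∏ σ, γu σ ^ A n σ : Kˣ) : K)) * ((k : K))⁻¹ := by
      rw [Units.val_mul, Units.val_inv_eq_inv_val]
      field_simp
      ring
    rw [e]
    exact h1
  -- embeddings converge: `ι τ(P_n) → ι τ(k)`
  have hconv : ∀ τ : K →+* PadicAlgCl ℓ,
      Tendsto (fun n => ιE (τ ((∏ σ, γu σ ^ A n σ : Kˣ) : K))) atTop (𝓝 (ιE (τ (k : K)))) := by
    intro τ
    rw [tendsto_iff_norm_sub_tendsto_zero]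
    have hb : ∀ n, ‖ιE (τ ((∏ σ, γu σ ^ A n σ : Kˣ) : K)) - ιE (τ (k : K))‖ ≤ q ^ (s + n) := by
      intro n
      rw [← map_sub, hι, norm_sub_rev]
      exact norm_embedding_sub_le_of_cong (hA n) τ
    have hlim : Tendsto (fun n : ℕ => q ^ (s + n)) atTop (𝓝 0) := by
      have h := tendsto_pow_atTop_nhds_zero_of_lt_one hq0.le hq1
      have : (fun n : ℕ => q ^ (s + n)) = fun n => q ^ s * q ^ n := by
        funext n; rw [pow_add]
      rw [this]
      simpa using h.const_mul (q ^ s)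
    exact squeeze_zero_norm' (Eventually.of_forall fun n => by
      rw [Real.norm_eq_abs, abs_of_nonneg (norm_nonneg _)]; exact hb n) hlim
  -- logarithms converge
  have hAL : ∀ τ : K →+* PadicAlgCl ℓ, Tendsto (fun n => ∑' m : ℕ,
      -((1 - ιE (τ ((∏ σ, γu σ ^ A n σ : Kˣ) : K))) ^ (m + 1)) / (m + 1 : E)) atTop
      (𝓝 (∑' m : ℕ, -((1 - ιE (τ (k : K))) ^ (m + 1)) / (m + 1 : E))) := by
    intro τ
    rw [tendsto_iff_norm_sub_tendsto_zero]
    -- `‖L(y_n) - L(y)‖ ≤ ‖1 - y_n / y‖ ≤ q^{s+n}`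
    have hPn1 : ∀ n, ‖1 - ιE (τ ((∏ σ, γu σ ^ A n σ : Kˣ) : K))‖ < 1 := by
      intro n
      have hmon := Cong.monomial_sub_one (K := K) (ℓ := ℓ) (fun σ => bO σ) s (A n)
      have hcoe : ((∏ σ, γu σ ^ A n σ : Kˣ) : K) =
          ∏ σ, (1 + (ℓ : K) ^ s * ((bO σ : 𝓞 K) : K)) ^ A n σ := by
        rw [Units.coe_prod]
        refine Finset.prod_congr rfl fun σ _ => ?_
        rw [Units.val_pow_eq_pow_val, hγuval]
      rw [← map_one ιE, ← map_sub, hι, ← map_one τ, ← map_sub, ← neg_sub, map_neg, norm_neg, hcoe]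
      exact (norm_embedding_le_of_cong hmon τ).trans_lt hqs1
    have hy1 : ‖1 - ιE (τ (k : K))‖ < 1 := (hk1 τ).trans_lt hqs1
    have hb : ∀ n, ‖(∑' m : ℕ, -((1 - ιE (τ ((∏ σ, γu σ ^ A n σ : Kˣ) : K))) ^ (m + 1)) /
        (m + 1 : E)) - ∑' m : ℕ, -((1 - ιE (τ (k : K))) ^ (m + 1)) / (m + 1 : E)‖ ≤
        q ^ (s + n) := by
      intro n
      have hquotnorm : ‖1 - ιE (τ ((∏ σ, γu σ ^ A n σ : Kˣ) : K)) / ιE (τ (k : K))‖ ≤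
          q ^ (s + n) := by
        have e : ιE (τ ((∏ σ, γu σ ^ A n σ : Kˣ) : K)) / ιE (τ (k : K)) =
            ιE (τ ((((∏ σ, γu σ ^ A n σ) * k⁻¹ : Kˣ) : K))) := by
          rw [Units.val_mul, Units.val_inv_eq_inv_val, map_mul, map_inv₀, map_mul, map_inv₀,
            div_eq_mul_inv]
        rw [e, ← map_one ιE, ← map_sub, hι, ← map_one τ, ← map_sub, ← neg_sub, map_neg, norm_neg]
        exact norm_embedding_le_of_cong (hquot n) τ
      have hhalf : ‖1 - ιE (τ ((∏ σ, γu σ ^ A n σ : Kˣ) : K)) / ιE (τ (k : K))‖ ≤ 1 / 2 :=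
        hquotnorm.trans ((pow_le_pow_of_le_one hq0.le hq1.le
          (Nat.le_add_right s n)).trans (hqs4.trans (by norm_num)))
      exact (LogE.norm_logSeries_sub_le (ℓ := ℓ) (hPn1 n) hy1 hhalf).trans hquotnorm
    have hlim : Tendsto (fun n : ℕ => q ^ (s + n)) atTop (𝓝 0) := by
      have h := tendsto_pow_atTop_nhds_zero_of_lt_one hq0.le hq1
      have : (fun n : ℕ => q ^ (s + n)) = fun n => q ^ s * q ^ n := by
        funext n; rw [pow_add]
      rw [this]
      simpa using h.const_mul (q ^ s)
    exact squeeze_zero_norm' (Eventually.of_forall fun n => by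
      rw [Real.norm_eq_abs, abs_of_nonneg (norm_nonneg _)]; exact hb n) hlim
  -- ### the avatar: `Φ_F(P_n) → Φ_F(k)`
  have hAΦF : Tendsto (fun n => ΦF (∏ σ, γu σ ^ A n σ)) atTop (𝓝 (ΦF k)) := by
    have hsplit : ∀ n, ΦF (∏ σ, γu σ ^ A n σ) = ΦF k * ΦF ((∏ σ, γu σ ^ A n σ) * k⁻¹) := by
      intro n
      rw [← map_mul, mul_comm, inv_mul_cancel_right]
    simp_rw [hsplit]
    rw [show 𝓝 (ΦF k) = 𝓝 (ΦF k * 1) by rw [mul_one]]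
    refine Tendsto.const_mul _ ?_
    rw [Metric.tendsto_nhds]
    intro δ' hδ'
    obtain ⟨j₁, -, hj₁⟩ := exists_forall_norm_prod_sub_one_lt Ψ ιE hι L hL hδ'
    rw [eventually_atTop]
    refine ⟨j₁, fun n hn => ?_⟩
    rw [dist_eq_norm, hΦF]
    exact hj₁ _ (Cong.mono (hquot n) (by omega))
  have hΦFmul : ∀ A' : (K →+* PadicAlgCl ℓ) → ℕ,
      ΦF (∏ σ, γu σ ^ A' σ) = ∏ σ, ΦF (γu σ) ^ A' σ := by
    intro A'
    rw [map_prod]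
    simp only [map_pow]
  obtain ⟨hFnorm, hFeq⟩ := key ιE γu hγ1 M M⁻¹ hM hMinv hr0 hrq cF hcF ΦF
    (fun σ => (hexpF σ).symm) hΦFmul k A hAL hAΦF
  -- ### the embeddings `τ₀`
  have hτ : ∀ τ₀ : K →+* PadicAlgCl ℓ,
      ‖∑ τ, (M⁻¹ *ᵥ cτ τ₀) τ * ∑' m : ℕ, -((1 - ιE (τ (k : K))) ^ (m + 1)) / (m + 1 : E)‖ < r ∧
      ιE (τ₀ (k : K)) =
        exp (∑ τ, (M⁻¹ *ᵥ cτ τ₀) τ * ∑' m : ℕ, -((1 - ιE (τ (k : K))) ^ (m + 1)) / (m + 1 : E)) := by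
    intro τ₀
    set Φτ : Kˣ →* E := (ιE.toMonoidHom.comp (τ₀ : K →* PadicAlgCl ℓ)).comp (Units.coeHom K)
      with hΦτdef
    have hΦτ : ∀ u : Kˣ, Φτ u = ιE (τ₀ (u : K)) := fun u => rfl
    have hΦτmul : ∀ A' : (K →+* PadicAlgCl ℓ) → ℕ,
        Φτ (∏ σ, γu σ ^ A' σ) = ∏ σ, Φτ (γu σ) ^ A' σ := by
      intro A'
      rw [map_prod]
      simp only [map_pow]
    have h := key ιE γu hγ1 M M⁻¹ hM hMinv hr0 hrq (cτ τ₀) (hcτ τ₀) Φτ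
      (fun σ => by rw [hΦτ]; exact (hexpτ τ₀ σ).symm) hΦτmul k A hAL
      (by simpa only [hΦτ] using hconv τ₀)
    simpa only [hΦτ] using h
  refine ⟨hk1, hFnorm.trans_le hrε, ?_, fun τ₀ => ⟨(hτ τ₀).1.trans_le hrε, (hτ τ₀).2⟩⟩
  rw [← hΦF]
  exact hFeq

end Expansion

end Literature.NumberTheory.GaloisRepresentations

end PartA3c
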